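import Literature.NumberTheory.LFunctions.HeilbronnPhenomenonWideRangeProofs
import HarnessLib

/-!
# The Heilbronn phenomenon in the range `γ < 1/4`, sharper exponent window `b > 5/(2(1 − 4γ))`
# (Bellotti–Puglisi 2023, Theorems 2–3 / Corollary 3, repaired) — PROVED

This file continues `Literature.NumberTheory.LFunctions.HeilbronnPhenomenonWideRangeProofs`
(Bellotti–Puglisi, *An elementary proof of the Deuring–Heilbronn phenomenon*, Acta Arith. 208
(2023), §3–4), where Theorems 2–3 and Corollary 3 were proved with the exponent window
`b > 4/(1 − 4γ)` (cut of the hyperbola sum at `U^{b/2}`, trivial character-sum bounds). Here the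
same elementary road is run with the paper's general cut `U^{b/h}` optimised, namely
`N₁ = ⌊U^a⌋`, `a = bγ + b/4 − 1/8`, and with the Pólya–Vinogradov bound `|Σ_{n≤x} χ_D(n)| ≤ 9√D log D`
(the tree's `Pintz1976Heilbronn.norm_partialSum_le_nine`) inside the Montgomery–Vaughan error terms
for `Σ g_D(c)/c` (second cut `Y₁ = ⌊√(N₁⌈9√D log D⌉)⌋`). This proves the three statements in the
wider window

* Theorem 2′/3′: `b > 5/(2(1 − 4γ))` (`bellottiPuglisi2023_theorem2_sharperB`,
  `bellottiPuglisi2023_theorem3_sharperB`),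
* Corollary 3′: `b > 5/(1 − 4γ)` (`bellottiPuglisi2023_corollary3_sharperB`),

with the bodies of the named facts `bellottiPuglisi2023_theorem2/3/corollary3` of
`Literature.NumberTheory.LFunctions.ElementaryDeuringHeilbronnPhenomenon` otherwise verbatim. The
printed window `1/(2(1 − 3γ)) < b < 1/(2γ)` is not delivered by the printed argument (see the ERRATA
section of that statement file); the present window is what the printed method gives when every
estimate is carried uniformly in `k|s₀|D`.

## Architecture (mirrors §3 of the paper at a general cut)

* Part K — the two ranges `c ≤ N₁` and `N₁ < c ≤ N = M²` of the weighted hyperbola sum (the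
  paper's (4), (9), (10)) at a general cut (`sigma_one_le_gen`, `sigma_two_le_gen`).
* Part L — the divisor-sum block `Σ_{N₁<c≤N} g_D(c)/c` by Montgomery–Vaughan Exercise 11.2.3(g)
  differenced between two cuts, with a generic partial-sum bound (`sum_charDivisorSum_div_le_cut`).
* Part M — the upper chain `|Σ_{l≤M} χ_k(l²)l^{-2s}| ≤ Σ₁ + Σ₂` (`upper_chain_cut`).
* Part N — thresholds in `U` (`eventually_thresholds_sharp`), the endgame arithmetic
  (`endgame_gen2`) and the power bookkeeping for the cut (`cut_power_facts`).
* Part O — the large-`U` case (`large_case_sharp`), the uniform cores (`theorem2_core_sharp`,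
  `theorem3_core_sharp`, Page's step from the tree) and the three theorems; Corollary 3′ through
  `BellottiPuglisi2023.corollary3_oneway` of the `h = 2` file at exponent `b/2`.

Exponent count: with `L = log U`, `Σ₁ ≪ (b+2)³L³·U^{aγ+1+(b−a)(γ−½)} = (b+2)³L³U^{−3e}` and the
error part of `Σ₂` is `≪ (b+2)³L⁴·U^{bγ}·U^{¼−a/2} = (b+2)³L⁴U^{−e}`, `e = b(1−4γ)/8 − 5/16`,
positive exactly when `b > 5/(2(1 − 4γ))`; the lower bound `|Σ_{l≤M} χ_k(l²)l^{-2s}| ≥ 0.028`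
(`M ≥ 144`, real `χ_k`; or `Re s ≥ 7/8`) is Part C′ of the `h = 2` file.

## References

* [BellottiPuglisi2023] C. Bellotti, G. Puglisi, *An elementary proof of the Deuring–Heilbronn
  phenomenon*, Acta Arith. 208 (2023), no. 3, 257–277; arXiv:2201.03990. Theorems 2–3 p. 4,
  Corollary 3 p. 5, §3 pp. 11–16, §4 p. 16.
* [MontgomeryVaughan2007] H. L. Montgomery, R. C. Vaughan, *Multiplicative Number Theory I*,
  CUP 2007, §9.4 Thm. 9.18 (Pólya–Vinogradov), §11.2.1 Exercise 3.
* [Pintz1976ElementaryIV] J. Pintz, *Elementary methods in the theory of L-functions IV. The Heilbronn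
  phenomenon*, Acta Arith. 31 (1976), 419–429.
-/

noncomputable section

open Complex Finset ArithmeticFunction Filter Topology

namespace Literature.NumberTheory.LFunctions

namespace BellottiPuglisi2023

open Pintz1976Heilbronn DirichletAbel RealChar

variable {q : ℕ} (χ : DirichletCharacter ℂ q) {k : ℕ} (χk : DirichletCharacter ℂ k)

/-! ### Part K — the two ranges at a general cut `N₁ ≤ N` (BP's `U^{b/h}`, `h ≠ 2`) -/

/-- **(4)/(9), the range `c ≤ N₁` at a general cut**: using (3.13) for `S(N/c)` (`N/c ≥ N/N₁`),
`Σ_{c ≤ N₁} g_D(c) c^{-σ} ‖S(N/c)‖ ≤ (Σ_{c ≤ N₁} τ(c)/c) · N₁^{1-σ} · 4kD(1 + ‖s‖/σ)(2 + log N) ⌊N/N₁⌋^{1/2-σ}`.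
[cite: BellottiPuglisi2023, §3 (4) and (9) pp. 11–13] -/
theorem sigma_one_le_gen [NeZero k] [NeZero q] (hq : χ ^ 2 = 1) (hχk : χk ≠ 1)
    (hψ : prodChar χ χk ≠ 1) {s : ℂ} (hhalf : 1 / 2 ≤ s.re) (hs1 : s.re ≤ 1)
    (hL : χk.LFunction s = 0) {N₁ N : ℕ} (hN₁ : 1 ≤ N₁) (hN₁N : N₁ ≤ N) :
    ∑ c ∈ Ioc 0 N₁, charDivisorSum χ c * (c : ℝ) ^ (-s.re) * ‖innerSum χ χk s (N / c)‖ ≤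
      (∑ c ∈ Ioc 0 N₁, (c.divisors.card : ℝ) / c) *
        ((N₁ : ℝ) ^ (1 - s.re) * (4 * ((k * q : ℕ) : ℝ) * (1 + ‖s‖ / s.re) *
          (2 + Real.log (N : ℝ)) * ((N / N₁ : ℕ) : ℝ) ^ (1 / 2 - s.re))) := by
  have hs0 : 0 < s.re := by linarith
  have hN₁0 : (0 : ℝ) < N₁ := by exact_mod_cast hN₁
  have hN1 : 1 ≤ N := hN₁.trans hN₁N
  have hM₀1 : 1 ≤ N / N₁ := (Nat.one_le_div_iff (by omega)).mpr hN₁N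
  have hM₀0 : (0 : ℝ) < ((N / N₁ : ℕ) : ℝ) := by exact_mod_cast hM₀1
  set B : ℝ := 4 * ((k * q : ℕ) : ℝ) * (1 + ‖s‖ / s.re) *
    (2 + Real.log (N : ℝ)) * ((N / N₁ : ℕ) : ℝ) ^ (1 / 2 - s.re) with hB
  have hA0 : 0 ≤ 1 + ‖s‖ / s.re := by
    have : 0 ≤ ‖s‖ / s.re := div_nonneg (norm_nonneg _) hs0.le; positivity
  have hlogN : 0 ≤ Real.log (N : ℝ) := Real.log_nonneg (by exact_mod_cast hN1)
  have hB0 : 0 ≤ B := by positivity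
  rw [sum_mul]
  refine sum_le_sum fun c hc => ?_
  have hc0 : 0 < c := (mem_Ioc.mp hc).1
  have hcN₁ : c ≤ N₁ := (mem_Ioc.mp hc).2
  have hc0' : (0 : ℝ) < c := by exact_mod_cast hc0
  -- `M = N/c ≥ N/N₁ ≥ 1`
  have hMM₀ : N / N₁ ≤ N / c := Nat.div_le_div_left hcN₁ hc0
  have hM1 : 1 ≤ N / c := hM₀1.trans hMM₀
  have hMN : N / c ≤ N := Nat.div_le_self _ _
  have hM0 : (0 : ℝ) < ((N / c : ℕ) : ℝ) := by exact_mod_cast hM1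
  -- `‖S(M)‖ ≤ B`
  have hS : ‖innerSum χ χk s (N / c)‖ ≤ B := by
    refine (norm_innerSum_le χ χk hq hχk hψ hhalf hs1 hL hM1).trans ?_
    have hlog : Real.log ((N / c : ℕ) : ℝ) ≤ Real.log (N : ℝ) :=
      Real.log_le_log hM0 (by exact_mod_cast hMN)
    have hpow : ((N / c : ℕ) : ℝ) ^ (1 / 2 - s.re) ≤ ((N / N₁ : ℕ) : ℝ) ^ (1 / 2 - s.re) :=
      Real.rpow_le_rpow_of_nonpos hM₀0 (by exact_mod_cast hMM₀) (by linarith)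
    have hlogM : 0 ≤ Real.log ((N / c : ℕ) : ℝ) := Real.log_nonneg (by exact_mod_cast hM1)
    simp only [hB]
    gcongr
  have hτ : charDivisorSum χ c ≤ (c.divisors.card : ℝ) :=
    (le_abs_self _).trans (abs_charDivisorSum_le χ c)
  have hr0 : 0 ≤ charDivisorSum χ c := charDivisorSum_nonneg χ hq c
  have hcpow : (c : ℝ) ^ (-s.re) ≤ (1 / (c : ℝ)) * (N₁ : ℝ) ^ (1 - s.re) := by
    have e : (c : ℝ) ^ (-s.re) = (1 / (c : ℝ)) * (c : ℝ) ^ (1 - s.re) := by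
      rw [one_div, ← Real.rpow_neg_one, ← Real.rpow_add hc0']; ring_nf
    rw [e]
    exact mul_le_mul_of_nonneg_left
      (Real.rpow_le_rpow hc0'.le (by exact_mod_cast hcN₁) (by linarith)) (by positivity)
  calc charDivisorSum χ c * (c : ℝ) ^ (-s.re) * ‖innerSum χ χk s (N / c)‖
      ≤ (c.divisors.card : ℝ) * ((1 / (c : ℝ)) * (N₁ : ℝ) ^ (1 - s.re)) * B := by
        gcongr
    _ = (c.divisors.card : ℝ) / c * ((N₁ : ℝ) ^ (1 - s.re) * B) := by ring

/-- **(4)/(10), the range `N₁ < c ≤ N` at a general cut**: with `S` bounded trivially and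
`(cm)^{-σ} ≤ N^{1-σ}/(cm)`,
`Σ_{N₁ < c ≤ N} g_D(c) c^{-σ} ‖S(N/c)‖ ≤ N^{1-σ} (½log²N + 2 log N + 2) Σ_{N₁ < c ≤ N} g_D(c)/c`.
[cite: BellottiPuglisi2023, §3 (4) and (10) pp. 11–14] -/
theorem sigma_two_le_gen (hq : χ ^ 2 = 1) {s : ℂ} (hs1 : s.re ≤ 1) {N₁ N : ℕ} (hN₁ : 1 ≤ N₁)
    (hN₁N : N₁ ≤ N) :
    ∑ c ∈ Ioc N₁ N, charDivisorSum χ c * (c : ℝ) ^ (-s.re) * ‖innerSum χ χk s (N / c)‖ ≤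
      (N : ℝ) ^ (1 - s.re) * (Real.log N ^ 2 / 2 + 2 * Real.log N + 2) *
        ∑ c ∈ Ioc N₁ N, charDivisorSum χ c / c := by
  have hN1 : 1 ≤ N := hN₁.trans hN₁N
  have hN0 : (0 : ℝ) < N := by exact_mod_cast hN1
  have hlogN0 : 0 ≤ Real.log N := Real.log_nonneg (by exact_mod_cast hN1)
  set Q : ℝ := Real.log N ^ 2 / 2 + 2 * Real.log N + 2 with hQ
  have hQ0 : 0 ≤ Q := by positivity
  rw [mul_sum]
  refine sum_le_sum fun c hc => ?_
  have hN₁c : N₁ < c := (mem_Ioc.mp hc).1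
  have hcN : c ≤ N := (mem_Ioc.mp hc).2
  have hc0 : 0 < c := by omega
  have hc0' : (0 : ℝ) < c := by exact_mod_cast hc0
  have hr0 : 0 ≤ charDivisorSum χ c := charDivisorSum_nonneg χ hq c
  have hM1 : 1 ≤ N / c := (Nat.one_le_div_iff hc0).mpr hcN
  have hMN : N / c ≤ N := Nat.div_le_self _ _
  have hS := norm_innerSum_le_sum χ χk s (N / c)
  have hterm : ∀ m ∈ Ioc 0 (N / c), charDivisorSum χ c * (c : ℝ) ^ (-s.re) *
      ((m.divisors.card : ℝ) * (m : ℝ) ^ (-s.re)) ≤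
      (N : ℝ) ^ (1 - s.re) * (charDivisorSum χ c / c * ((m.divisors.card : ℝ) / m)) := by
    intro m hm
    have hm0 : 0 < m := (mem_Ioc.mp hm).1
    have hm0' : (0 : ℝ) < m := by exact_mod_cast hm0
    have hcm : c * m ≤ N := by
      have := (mem_Ioc.mp hm).2
      rw [mul_comm]; exact (Nat.le_div_iff_mul_le hc0).mp this
    have hcm' : ((c : ℝ) * m) ≤ N := by exact_mod_cast hcm
    have hpow : (c : ℝ) ^ (-s.re) * (m : ℝ) ^ (-s.re) ≤
        (N : ℝ) ^ (1 - s.re) * (1 / ((c : ℝ) * m)) := by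
      rw [← Real.mul_rpow hc0'.le hm0'.le]
      have e : ((c : ℝ) * m) ^ (-s.re) = ((c : ℝ) * m) ^ (1 - s.re) * (1 / ((c : ℝ) * m)) := by
        rw [one_div, ← Real.rpow_neg_one, ← Real.rpow_add (by positivity)]; ring_nf
      rw [e]
      exact mul_le_mul_of_nonneg_right
        (Real.rpow_le_rpow (by positivity) hcm' (by linarith)) (by positivity)
    calc charDivisorSum χ c * (c : ℝ) ^ (-s.re) * ((m.divisors.card : ℝ) * (m : ℝ) ^ (-s.re))
        = charDivisorSum χ c * (m.divisors.card : ℝ) * ((c : ℝ) ^ (-s.re) * (m : ℝ) ^ (-s.re)) := by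
          ring
      _ ≤ charDivisorSum χ c * (m.divisors.card : ℝ) *
          ((N : ℝ) ^ (1 - s.re) * (1 / ((c : ℝ) * m))) :=
          mul_le_mul_of_nonneg_left hpow (by positivity)
      _ = (N : ℝ) ^ (1 - s.re) * (charDivisorSum χ c / c * ((m.divisors.card : ℝ) / m)) := by
          field_simp
  have hsumτ := sum_card_divisors_div_le (N / c)
  have hlogM : Real.log ((N / c : ℕ) : ℝ) ≤ Real.log N :=
    Real.log_le_log (by exact_mod_cast hM1) (by exact_mod_cast hMN)
  have hlogM0 : 0 ≤ Real.log ((N / c : ℕ) : ℝ) := Real.log_nonneg (by exact_mod_cast hM1)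
  have hQM : Real.log ((N / c : ℕ) : ℝ) ^ 2 / 2 + 2 * Real.log ((N / c : ℕ) : ℝ) + 2 ≤ Q := by
    simp only [hQ]; gcongr
  calc charDivisorSum χ c * (c : ℝ) ^ (-s.re) * ‖innerSum χ χk s (N / c)‖
      ≤ charDivisorSum χ c * (c : ℝ) ^ (-s.re) *
          ∑ m ∈ Ioc 0 (N / c), (m.divisors.card : ℝ) * (m : ℝ) ^ (-s.re) :=
        mul_le_mul_of_nonneg_left hS (by positivity)
    _ = ∑ m ∈ Ioc 0 (N / c), charDivisorSum χ c * (c : ℝ) ^ (-s.re) *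
          ((m.divisors.card : ℝ) * (m : ℝ) ^ (-s.re)) := by rw [mul_sum]
    _ ≤ ∑ m ∈ Ioc 0 (N / c), (N : ℝ) ^ (1 - s.re) *
          (charDivisorSum χ c / c * ((m.divisors.card : ℝ) / m)) := sum_le_sum hterm
    _ = (N : ℝ) ^ (1 - s.re) * (charDivisorSum χ c / c) *
          ∑ m ∈ Ioc 0 (N / c), (m.divisors.card : ℝ) / m := by
        rw [mul_sum]
        refine sum_congr rfl fun m _ => by ring
    _ ≤ (N : ℝ) ^ (1 - s.re) * (charDivisorSum χ c / c) * Q :=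
        mul_le_mul_of_nonneg_left (hsumτ.trans hQM) (by positivity)
    _ = (N : ℝ) ^ (1 - s.re) * Q * (charDivisorSum χ c / c) := by ring

/-! ### Part L — the divisor-sum block between two cuts, with a generic character-sum bound `B` -/

/-- **The divisor-sum block between two cuts with a generic partial-sum bound** `|Σ_{n≤x}χ_D(n)| ≤ B`
(Pólya–Vinogradov quality allowed): for `2 ≤ Y₁ ≤ N₁ ≤ N`, quadratic `χ_D ≠ χ₀`,
`Σ_{N₁ < c ≤ N} g_D(c)/c ≤ (log N − log N₁)·L(1,χ_D) + [8B(log N+1)/(N₁+1) + 4N₁/N] + [8B(log N₁+1)/(Y₁+1) + 4Y₁/N₁]`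
(the tree's Montgomery–Vaughan Exercise 11.2.3(g), differenced). [cite: BellottiPuglisi2023, §3 (10) p. 14] -/
theorem sum_charDivisorSum_div_le_cut [NeZero q] (hq : χ ^ 2 = 1) (hχ : χ ≠ 1) {B : ℝ}
    (hB : ∀ n, ‖partialSum χ n‖ ≤ B) {Y₁ N₁ N : ℕ} (hY₁ : 2 ≤ Y₁) (hY₁N₁ : Y₁ ≤ N₁)
    (hN₁N : N₁ ≤ N) :
    ∑ c ∈ Ioc N₁ N, charDivisorSum χ c / (c : ℝ) ≤
      (Real.log N - Real.log N₁) * (χ.LFunction 1).re +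
        (8 * B * (Real.log N + 1) / ((N₁ : ℝ) + 1) + 4 * (N₁ : ℝ) / N) +
        (8 * B * (Real.log N₁ + 1) / ((Y₁ : ℝ) + 1) + 4 * (Y₁ : ℝ) / N₁) := by
  have hN₁2 : 2 ≤ N₁ := hY₁.trans hY₁N₁
  have e1 := norm_sum_divisorSum_div_sub_le χ hχ hB hN₁2 hN₁N
  have e2 := norm_sum_divisorSum_div_sub_le χ hχ hB hY₁ hY₁N₁
  set Lχ : ℂ := χ.LFunction 1
  set Lχ' : ℂ := deriv χ.LFunction 1
  set mN : ℂ := (((Real.log N + Real.eulerMascheroniConstant : ℝ)) : ℂ) * Lχ + Lχ'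
  set mN₁ : ℂ := (((Real.log N₁ + Real.eulerMascheroniConstant : ℝ)) : ℂ) * Lχ + Lχ'
  have hmain : mN - mN₁ = ((Real.log N - Real.log N₁ : ℝ) : ℂ) * Lχ := by
    simp only [mN, mN₁]
    push_cast
    ring
  have hG : ((∑ c ∈ Ioc N₁ N, charDivisorSum χ c / (c : ℝ) : ℝ) : ℂ) =
      (divSumC χ N - mN) - (divSumC χ N₁ - mN₁) + ((Real.log N - Real.log N₁ : ℝ) : ℂ) * Lχ := by
    rw [ofReal_sum_Ioc_charDivisorSum_div χ hq hN₁N, ← hmain]; ring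
  have hre : ∑ c ∈ Ioc N₁ N, charDivisorSum χ c / (c : ℝ) =
      ((divSumC χ N - mN) - (divSumC χ N₁ - mN₁)).re +
        (Real.log N - Real.log N₁) * Lχ.re := by
    have := congrArg Complex.re hG
    rw [ofReal_re] at this
    rw [this, add_re, re_ofReal_mul]
  rw [hre]
  have hre_le : ((divSumC χ N - mN) - (divSumC χ N₁ - mN₁)).re ≤
      ‖divSumC χ N - mN‖ + ‖divSumC χ N₁ - mN₁‖ :=
    (re_le_norm _).trans (norm_sub_le _ _)
  have hE1 : ‖divSumC χ N - mN‖ ≤ 8 * B * (Real.log N + 1) / ((N₁ : ℝ) + 1) + 4 * (N₁ : ℝ) / N := e1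
  have hE2 : ‖divSumC χ N₁ - mN₁‖ ≤ 8 * B * (Real.log N₁ + 1) / ((Y₁ : ℝ) + 1) + 4 * (Y₁ : ℝ) / N₁ :=
    e2
  linarith

/-! ### Part M — the upper chain at a general cut -/

/-- **The upper chain at a general cut `N₁ ≤ N = M²`.** For quadratic `χ_D ≠ χ₀` mod `D` with a
partial-sum bound `B`, `χ_k ≠ χ₀` with `χ_kχ_D ≠ χ₀`, a zero `s` of `L(·,χ_k)` with `½ ≤ Re s ≤ 1`,
`2 ≤ Y₁ ≤ N₁ ≤ M²`: `‖Σ_{l ≤ M} χ_k(l²)(l²)^{-s}‖ ≤ Σ₁ + Σ₂` with the bounds of Parts K–L.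
[cite: BellottiPuglisi2023, §3 (4), (9), (10) pp. 11–14] -/
theorem upper_chain_cut [NeZero k] [NeZero q] (hq : χ ^ 2 = 1) (hχ : χ ≠ 1) (hχk : χk ≠ 1)
    (hψ : prodChar χ χk ≠ 1) {s : ℂ} (hhalf : 1 / 2 ≤ s.re) (hs1 : s.re ≤ 1)
    (hL : χk.LFunction s = 0) {B : ℝ} (hB : ∀ n, ‖partialSum χ n‖ ≤ B) {Y₁ N₁ M : ℕ}
    (hY₁ : 2 ≤ Y₁) (hY₁N₁ : Y₁ ≤ N₁) (hN₁N : N₁ ≤ M ^ 2) :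
    ‖∑ l ∈ Ioc 0 M, χk ((l ^ 2 : ℕ) : ZMod k) * ((l ^ 2 : ℕ) : ℂ) ^ (-s)‖ ≤
      (∑ c ∈ Ioc 0 N₁, (c.divisors.card : ℝ) / c) *
          ((N₁ : ℝ) ^ (1 - s.re) * (4 * ((k * q : ℕ) : ℝ) * (1 + ‖s‖ / s.re) *
            (2 + Real.log (((M ^ 2 : ℕ)) : ℝ)) * (((M ^ 2 / N₁ : ℕ)) : ℝ) ^ (1 / 2 - s.re))) +
        (((M ^ 2 : ℕ)) : ℝ) ^ (1 - s.re) *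
          (Real.log (((M ^ 2 : ℕ)) : ℝ) ^ 2 / 2 + 2 * Real.log (((M ^ 2 : ℕ)) : ℝ) + 2) *
          ((Real.log (((M ^ 2 : ℕ)) : ℝ) - Real.log N₁) * (χ.LFunction 1).re +
            (8 * B * (Real.log (((M ^ 2 : ℕ)) : ℝ) + 1) / ((N₁ : ℝ) + 1) +
              4 * (N₁ : ℝ) / (((M ^ 2 : ℕ)) : ℝ)) +
            (8 * B * (Real.log N₁ + 1) / ((Y₁ : ℝ) + 1) + 4 * (Y₁ : ℝ) / N₁)) := by
  have hN₁1 : 1 ≤ N₁ := le_trans (by omega) hY₁N₁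
  set N : ℕ := M ^ 2 with hNdef
  have e1 := sum_sqInd_eq_sum_sq (fun n => χk n * (n : ℂ) ^ (-s)) M
  have e2 := sum_sqInd_eq_sum_weight_mul_innerSum χ χk hq s N
  have hid : ∑ l ∈ Ioc 0 M, χk ((l ^ 2 : ℕ) : ZMod k) * ((l ^ 2 : ℕ) : ℂ) ^ (-s) =
      ∑ c ∈ Ioc 0 N, ((weight χ c : ℝ) : ℂ) * χk c * (c : ℂ) ^ (-s) *
        innerSum χ χk s (N / c) := e1.symm.trans e2
  rw [hid]
  have hnorm : ‖∑ c ∈ Ioc 0 N, ((weight χ c : ℝ) : ℂ) * χk c * (c : ℂ) ^ (-s) *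
        innerSum χ χk s (N / c)‖ ≤
      ∑ c ∈ Ioc 0 N, charDivisorSum χ c * (c : ℝ) ^ (-s.re) * ‖innerSum χ χk s (N / c)‖ :=
    (norm_sum_le _ _).trans (sum_le_sum fun c hc => norm_weight_term_le χ χk hq s (mem_Ioc.mp hc).1 _)
  have hsplit := (sum_Ioc_consecutive
    (fun c => charDivisorSum χ c * (c : ℝ) ^ (-s.re) * ‖innerSum χ χk s (N / c)‖)
    (Nat.zero_le N₁) hN₁N).symm
  have hS1 := sigma_one_le_gen χ χk hq hχk hψ hhalf hs1 hL hN₁1 hN₁N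
  have hS2 := sigma_two_le_gen χ χk hq hs1 hN₁1 hN₁N
  have hG := sum_charDivisorSum_div_le_cut χ hq hχ hB hY₁ hY₁N₁ hN₁N
  have hP0 : 0 ≤ (N : ℝ) ^ (1 - s.re) *
      (Real.log (N : ℝ) ^ 2 / 2 + 2 * Real.log (N : ℝ) + 2) := by
    have : 0 ≤ Real.log (N : ℝ) := Real.log_nonneg (by exact_mod_cast hN₁1.trans hN₁N)
    positivity
  have hS2' := hS2.trans (mul_le_mul_of_nonneg_left hG hP0)
  calc _ ≤ _ := hnorm
    _ = _ := hsplit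
    _ ≤ _ := add_le_add hS1 hS2'


/-! ### Part N — thresholds, power bookkeeping and the assembly with the cut `a = bγ + b/4 − 1/8` -/

/-- Logarithm bookkeeping: with `0 ≤ ℓ ≤ bL`, `L ≥ 1`, `b > 0`:
`ℓ²/2 + 2ℓ + 2 ≤ (b+2)²L²`, `ℓ + 1 ≤ (b+2)L`, `2 + ℓ ≤ (b+2)L`. [folklore] -/
private theorem logb_facts {ℓ L b : ℝ} (hℓ0 : 0 ≤ ℓ) (hℓL : ℓ ≤ b * L) (hL1 : 1 ≤ L)
    (hb : 0 < b) :
    ℓ ^ 2 / 2 + 2 * ℓ + 2 ≤ (b + 2) ^ 2 * L ^ 2 ∧ ℓ + 1 ≤ (b + 2) * L ∧ 2 + ℓ ≤ (b + 2) * L := by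
  have hL0 : 0 ≤ L := by linarith
  have hℓsq : ℓ ^ 2 ≤ (b * L) ^ 2 := pow_le_pow_left₀ hℓ0 hℓL 2
  have hLL : L ≤ L ^ 2 := by nlinarith
  have hbL : b * L ≤ b * L ^ 2 := mul_le_mul_of_nonneg_left hLL hb.le
  have h1 : ℓ ^ 2 / 2 + 2 * ℓ + 2 ≤ (b * L) ^ 2 / 2 + 2 * (b * L ^ 2) + 2 * L ^ 2 := by nlinarith
  have h2 : (b * L) ^ 2 / 2 + 2 * (b * L ^ 2) + 2 * L ^ 2 ≤ (b + 2) ^ 2 * L ^ 2 := by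
    nlinarith [mul_nonneg (sq_nonneg b) (sq_nonneg L), mul_nonneg hb.le (sq_nonneg L), sq_nonneg L]
  refine ⟨h1.trans h2, by nlinarith, by nlinarith⟩

/-- The thresholds for the sharper assembly, valid for all large real `U`: `145 ≤ U^{b/2}`,
`8 ≤ U^{b−a}`, `8 ≤ U^a`, `1 ≤ log U`, `A log⁴U·U^{−e} ≤ c`, `20 log U · U^{1/2 − a} ≤ 1`
(`b/2, b−a, a, e, a − 1/2 > 0`). [cite: BellottiPuglisi2023, §3 p. 14 (U ≥ U₀(γ))] -/
theorem eventually_thresholds_sharp {a b e A c : ℝ} (hba : a < b) (ha : 1 / 2 < a)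
    (he : 0 < e) (hA : 0 < A) (hc : 0 < c) :
    ∃ U₀ : ℝ, 1 ≤ U₀ ∧ ∀ U : ℝ, U₀ ≤ U →
      145 ≤ U ^ (b / 2) ∧ 8 ≤ U ^ (b - a) ∧ 8 ≤ U ^ a ∧ 1 ≤ Real.log U ∧
        A * Real.log U ^ 4 * U ^ (-e) ≤ c ∧ 20 * Real.log U * U ^ (1 / 2 - a) ≤ 1 := by
  have h4r : ∀ x : ℝ, Real.log x ^ (4 : ℝ) = Real.log x ^ 4 := fun x => by
    rw [show (4 : ℝ) = ((4 : ℕ) : ℝ) by norm_num, Real.rpow_natCast]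
  have h1r : ∀ x : ℝ, Real.log x ^ (1 : ℝ) = Real.log x := fun x => Real.rpow_one _
  have h1 : ∀ᶠ x : ℝ in atTop, 145 ≤ x ^ (b / 2) :=
    (tendsto_rpow_atTop (by linarith : 0 < b / 2)).eventually_ge_atTop 145
  have h2 : ∀ᶠ x : ℝ in atTop, 8 ≤ x ^ (b - a) :=
    (tendsto_rpow_atTop (by linarith : 0 < b - a)).eventually_ge_atTop 8
  have h3 : ∀ᶠ x : ℝ in atTop, 8 ≤ x ^ a :=
    (tendsto_rpow_atTop (by linarith : 0 < a)).eventually_ge_atTop 8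
  have h4 : ∀ᶠ x : ℝ in atTop, 1 ≤ Real.log x := Real.tendsto_log_atTop.eventually_ge_atTop 1
  have h5 : ∀ᶠ x : ℝ in atTop, A * Real.log x ^ 4 * x ^ (-e) ≤ c := by
    have hb' := (isLittleO_log_rpow_rpow_atTop (4 : ℝ) he).bound (show 0 < c / A by positivity)
    filter_upwards [hb', Filter.eventually_ge_atTop 1] with x hx hx1
    rw [h4r, Real.norm_of_nonneg (pow_nonneg (Real.log_nonneg hx1) 4),
      Real.norm_of_nonneg (Real.rpow_nonneg (by linarith) _)] at hx
    have hx0 : 0 < x := by linarith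
    have hxε : 0 < x ^ e := Real.rpow_pos_of_pos hx0 e
    rw [Real.rpow_neg hx0.le]
    calc A * Real.log x ^ 4 * (x ^ e)⁻¹ ≤ A * (c / A * x ^ e) * (x ^ e)⁻¹ := by gcongr
      _ = c := by field_simp
  have h6 : ∀ᶠ x : ℝ in atTop, 20 * Real.log x * x ^ (1 / 2 - a) ≤ 1 := by
    have ha' : 0 < a - 1 / 2 := by linarith
    have hb' := (isLittleO_log_rpow_rpow_atTop (1 : ℝ) ha').bound (show (0 : ℝ) < 1 / 20 by norm_num)
    filter_upwards [hb', Filter.eventually_ge_atTop 1] with x hx hx1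
    rw [h1r, Real.norm_of_nonneg (Real.log_nonneg hx1),
      Real.norm_of_nonneg (Real.rpow_nonneg (by linarith) _)] at hx
    have hx0 : 0 < x := by linarith
    have hxε : 0 < x ^ (a - 1 / 2) := Real.rpow_pos_of_pos hx0 _
    have e1 : x ^ (1 / 2 - a) = (x ^ (a - 1 / 2))⁻¹ := by
      rw [← Real.rpow_neg hx0.le]; congr 1; ring
    rw [e1]
    calc 20 * Real.log x * (x ^ (a - 1 / 2))⁻¹ ≤ 20 * (1 / 20 * x ^ (a - 1 / 2)) * (x ^ (a - 1 / 2))⁻¹ := by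
          gcongr
      _ = 1 := by field_simp
  obtain ⟨U₀, hU₀⟩ := Filter.eventually_atTop.mp (h1.and (h2.and (h3.and (h4.and (h5.and h6)))))
  refine ⟨max U₀ 1, le_max_right _ _, fun U hU => ?_⟩
  obtain ⟨a1, a2, a3, a4, a5, a6⟩ := hU₀ U ((le_max_left _ _).trans hU)
  exact ⟨a1, a2, a3, a4, a5, a6⟩

/-- **The endgame arithmetic (sharper assembly)**: from `0.028 ≤ S ≤ E + PQ(D·L₁ + R₁ + R₂)`,
`E + PQ(R₁ + R₂) ≤ 0.014` and `PQD ≤ C L³ P'` conclude `L₁ ≥ 0.014/(C P' L³)`.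
[cite: BellottiPuglisi2023, §3 p. 14] -/
theorem endgame_gen2 {S E P Q D R₁ R₂ L₁ C L P' : ℝ} (hlow : 0.028 ≤ S)
    (hup : S ≤ E + P * Q * (D * L₁ + R₁ + R₂)) (hsmall : E + P * Q * (R₁ + R₂) ≤ 0.014)
    (hPQD : P * Q * D ≤ C * L ^ 3 * P') (hPQD0 : 0 ≤ P * Q * D) (hC : 0 < C) (hL : 0 < L)
    (hP' : 0 < P') : 0.014 / (C * P' * L ^ 3) ≤ L₁ := by
  have hexp : P * Q * (D * L₁ + R₁ + R₂) = (P * Q * D) * L₁ + P * Q * (R₁ + R₂) := by ring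
  rw [hexp] at hup
  have h1 : 0.014 ≤ (P * Q * D) * L₁ := by linarith
  have hL₁0 : 0 < L₁ := by
    by_contra hle
    push Not at hle
    have : (P * Q * D) * L₁ ≤ 0 := mul_nonpos_of_nonneg_of_nonpos hPQD0 hle
    linarith
  have h2 : (P * Q * D) * L₁ ≤ (C * L ^ 3 * P') * L₁ :=
    mul_le_mul_of_nonneg_right hPQD hL₁0.le
  rw [div_le_iff₀ (by positivity)]
  nlinarith

/-- Power bookkeeping for the cut `N₁ = ⌊U^a⌋`, top `N = M²`, `M = ⌊U^{b/2}⌋`: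
the comparisons of `N₁^{γ'}`, `⌊N/N₁⌋^{γ'−1/2}`, `N^{γ'}`, `4N₁/N` with powers of `U`, and the
exponent identities `aγ + 1 + (b−a)(γ−½) = −3e`, `bγ + ¼ − a/2 = −e`, `bγ + a − b ≤ −e` for
`a = bγ + b/4 − 1/8`, `e = b(1−4γ)/8 − 5/16`. [folklore] -/
private theorem cut_power_facts {U a b γ γ' e : ℝ} {M N₁ : ℕ} (hU1 : 1 ≤ U)
    (ha : a = b * γ + b / 4 - 1 / 8) (he : e = b * (1 - 4 * γ) / 8 - 5 / 16)
    (hγ'0 : 0 < γ') (hγ'γ : γ' ≤ γ) (hγ4 : γ < 1 / 4) (hb : 0 < b)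
    (hMX : (M : ℝ) ≤ U ^ (b / 2)) (hXM : U ^ (b / 2) / 2 ≤ M) (hM1 : 1 ≤ (M : ℝ))
    (hN₁X : (N₁ : ℝ) ≤ U ^ a) (hN₁1 : 1 ≤ (N₁ : ℝ))
    (h8 : 8 ≤ U ^ (b - a)) (he0 : 0 ≤ e) :
    ((N₁ : ℝ) ^ γ' ≤ U ^ (a * γ)) ∧
      ((((M ^ 2 / N₁ : ℕ)) : ℝ) ^ (γ' - 1 / 2) ≤ 3 * U ^ ((b - a) * (γ - 1 / 2))) ∧
      ((((M ^ 2 : ℕ)) : ℝ) ^ γ' ≤ U ^ (b * γ')) ∧ (U ^ (b * γ') ≤ U ^ (b * γ)) ∧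
      (4 * (N₁ : ℝ) / (((M ^ 2 : ℕ)) : ℝ) ≤ 16 * U ^ (a - b)) ∧
      (U ^ (a * γ) * U * U ^ ((b - a) * (γ - 1 / 2)) = U ^ (-(3 * e))) ∧
      (U ^ (b * γ) * U ^ (1 / 4 - a / 2) = U ^ (-e)) ∧
      (U ^ (b * γ) * U ^ (a - b) ≤ U ^ (-e)) ∧ (U ^ (-(3 * e)) ≤ U ^ (-e)) ∧
      ((N₁ : ℝ) ≤ (((M ^ 2 : ℕ)) : ℝ)) ∧ (U ^ b / 4 ≤ (((M ^ 2 : ℕ)) : ℝ)) ∧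
      ((((M ^ 2 : ℕ)) : ℝ) ≤ U ^ b) := by
  have hU0 : 0 < U := by linarith
  have hN₁0 : (0 : ℝ) < N₁ := by linarith
  have hM0 : (0 : ℝ) < M := by linarith
  have hNr : (((M ^ 2 : ℕ)) : ℝ) = (M : ℝ) ^ 2 := by push_cast; ring
  have hXb : (U ^ (b / 2)) ^ 2 = U ^ b := by
    rw [← Real.rpow_natCast, ← Real.rpow_mul hU0.le]; norm_num
  have hNle : (((M ^ 2 : ℕ)) : ℝ) ≤ U ^ b := by
    rw [hNr, ← hXb]; exact pow_le_pow_left₀ hM0.le hMX 2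
  have hNge : U ^ b / 4 ≤ (((M ^ 2 : ℕ)) : ℝ) := by
    rw [hNr]
    have h0 : 0 ≤ U ^ (b / 2) / 2 := by positivity
    have := pow_le_pow_left₀ h0 hXM 2
    rw [div_pow, hXb] at this
    linarith
  have hN0 : 0 < (((M ^ 2 : ℕ)) : ℝ) := by rw [hNr]; positivity
  -- `N₁ ≤ N`
  have hab : U ^ a * U ^ (b - a) = U ^ b := by rw [← Real.rpow_add hU0]; ring_nf
  have hN₁N : (N₁ : ℝ) ≤ (((M ^ 2 : ℕ)) : ℝ) := by
    have h1 : U ^ a * 8 ≤ U ^ a * U ^ (b - a) := mul_le_mul_of_nonneg_left h8 (by positivity)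
    rw [hab] at h1
    linarith
  have hUa0 : 0 < U ^ a := by positivity
  refine ⟨?_, ?_, ?_, ?_, ?_, ?_, ?_, ?_, ?_, hN₁N, hNge, hNle⟩
  · calc (N₁ : ℝ) ^ γ' ≤ (U ^ a) ^ γ' := Real.rpow_le_rpow hN₁0.le hN₁X hγ'0.le
      _ = U ^ (a * γ') := by rw [← Real.rpow_mul hU0.le]
      _ ≤ U ^ (a * γ) := Real.rpow_le_rpow_of_exponent_le hU1 (by
          have : 0 < a := by rw [ha]; nlinarith
          nlinarith)
  · -- `⌊N/N₁⌋ ≥ U^{b−a}/8 ≥ 1`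
    have hdiv : U ^ (b - a) / 8 ≤ (((M ^ 2 / N₁ : ℕ)) : ℝ) := by
      have h1 : ((((M ^ 2 : ℕ)) : ℝ) / N₁) - 1 ≤ (((M ^ 2 / N₁ : ℕ)) : ℝ) := by
        have := Nat.lt_div_mul_add (a := M ^ 2) (b := N₁) (by exact_mod_cast hN₁1)
        have h2 : (((M ^ 2 : ℕ)) : ℝ) < (((M ^ 2 / N₁ : ℕ)) : ℝ) * N₁ + N₁ := by exact_mod_cast this
        rw [div_sub_one hN₁0.ne', div_le_iff₀ hN₁0]
        linarith
      have h3 : U ^ (b - a) / 4 ≤ (((M ^ 2 : ℕ)) : ℝ) / N₁ := by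
        rw [le_div_iff₀ hN₁0]
        calc U ^ (b - a) / 4 * N₁ ≤ U ^ (b - a) / 4 * U ^ a :=
              mul_le_mul_of_nonneg_left hN₁X (by positivity)
          _ = U ^ b / 4 := by rw [← hab]; ring
          _ ≤ _ := hNge
      linarith
    have hdiv1 : 1 ≤ U ^ (b - a) / 8 := by linarith
    have hdiv0 : 0 < U ^ (b - a) / 8 := by linarith
    calc (((M ^ 2 / N₁ : ℕ)) : ℝ) ^ (γ' - 1 / 2) ≤ (U ^ (b - a) / 8) ^ (γ' - 1 / 2) :=
          Real.rpow_le_rpow_of_nonpos hdiv0 hdiv (by linarith)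
      _ ≤ (U ^ (b - a) / 8) ^ (γ - 1 / 2) :=
          Real.rpow_le_rpow_of_exponent_le hdiv1 (by linarith)
      _ = U ^ ((b - a) * (γ - 1 / 2)) * (8 : ℝ) ^ (1 / 2 - γ) := by
          rw [Real.div_rpow (by positivity) (by norm_num), ← Real.rpow_mul hU0.le, div_eq_mul_inv,
            ← Real.rpow_neg (by norm_num), neg_sub]
      _ ≤ U ^ ((b - a) * (γ - 1 / 2)) * 3 := by
          apply mul_le_mul_of_nonneg_left _ (by positivity)
          have h1 : (8 : ℝ) ^ (1 / 2 - γ) ≤ (8 : ℝ) ^ (1 / 2 : ℝ) :=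
            Real.rpow_le_rpow_of_exponent_le (by norm_num) (by linarith)
          have h2 : (8 : ℝ) ^ (1 / 2 : ℝ) ≤ 3 := by
            rw [← Real.sqrt_eq_rpow, show (3 : ℝ) = Real.sqrt 9 by
              rw [show (9 : ℝ) = 3 ^ 2 by norm_num, Real.sqrt_sq (by norm_num)]]
            exact Real.sqrt_le_sqrt (by norm_num)
          exact h1.trans h2
      _ = 3 * U ^ ((b - a) * (γ - 1 / 2)) := by ring
  · calc (((M ^ 2 : ℕ)) : ℝ) ^ γ' ≤ (U ^ b) ^ γ' := Real.rpow_le_rpow hN0.le hNle hγ'0.le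
      _ = U ^ (b * γ') := by rw [← Real.rpow_mul hU0.le]
  · exact Real.rpow_le_rpow_of_exponent_le hU1 (by nlinarith)
  · rw [div_le_iff₀ hN0]
    have e1 : 16 * U ^ (a - b) * (U ^ b / 4) = 4 * U ^ a := by
      rw [show 16 * U ^ (a - b) * (U ^ b / 4) = 4 * (U ^ (a - b) * U ^ b) by ring,
        ← Real.rpow_add hU0]; ring_nf
    calc 4 * (N₁ : ℝ) ≤ 4 * U ^ a := by linarith
      _ = 16 * U ^ (a - b) * (U ^ b / 4) := e1.symm
      _ ≤ 16 * U ^ (a - b) * (((M ^ 2 : ℕ)) : ℝ) :=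
          mul_le_mul_of_nonneg_left hNge (by positivity)
  · rw [← Real.rpow_one U, ← Real.rpow_mul hU0.le, ← Real.rpow_mul hU0.le, ← Real.rpow_mul hU0.le,
      ← Real.rpow_add hU0, ← Real.rpow_add hU0]
    congr 1; rw [ha, he]; ring
  · rw [← Real.rpow_add hU0]; congr 1; rw [ha, he]; ring
  · rw [← Real.rpow_add hU0]
    refine Real.rpow_le_rpow_of_exponent_le hU1 ?_
    rw [ha, he]; nlinarith
  · exact Real.rpow_le_rpow_of_exponent_le hU1 (by linarith)


/-- Square-root bookkeeping: `B' ≤ 10√U·L`, `U^a/2 ≤ N₁` give `√(B'/N₁) ≤ 4.5·L·U^{1/4 − a/2}`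
(`L ≥ 1`). [folklore] -/
private theorem sqrt_ratio_le {U a L B' N₁ : ℝ} (hU1 : 1 ≤ U) (hL1 : 1 ≤ L)
    (hB' : B' ≤ 10 * Real.sqrt U * L) (hN₁ : U ^ a / 2 ≤ N₁) (hN₁0 : 0 < N₁) :
    Real.sqrt (B' / N₁) ≤ 4.5 * L * U ^ (1 / 4 - a / 2) := by
  have hU0 : 0 < U := by linarith
  have hUa0 : 0 < U ^ a := by positivity
  have h1 : B' / N₁ ≤ 20 * L * U ^ (1 / 2 - a) := by
    rw [div_le_iff₀ hN₁0]
    have e : 20 * L * U ^ (1 / 2 - a) * (U ^ a / 2) = 10 * Real.sqrt U * L := by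
      rw [Real.sqrt_eq_rpow, show 20 * L * U ^ (1 / 2 - a) * (U ^ a / 2) =
        10 * (U ^ (1 / 2 - a) * U ^ a) * L by ring, ← Real.rpow_add hU0]
      ring_nf
    calc B' ≤ 10 * Real.sqrt U * L := hB'
      _ = 20 * L * U ^ (1 / 2 - a) * (U ^ a / 2) := e.symm
      _ ≤ 20 * L * U ^ (1 / 2 - a) * N₁ := mul_le_mul_of_nonneg_left hN₁ (by positivity)
  have h2 : 20 * L * U ^ (1 / 2 - a) ≤ (4.5 * L * U ^ (1 / 4 - a / 2)) ^ 2 := by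
    have e : (4.5 * L * U ^ (1 / 4 - a / 2)) ^ 2 = 20.25 * L ^ 2 * U ^ (1 / 2 - a) := by
      have : (U ^ (1 / 4 - a / 2)) ^ 2 = U ^ (1 / 2 - a) := by
        rw [← Real.rpow_natCast, ← Real.rpow_mul hU0.le]; norm_num; ring_nf
      rw [mul_pow, mul_pow, this]; norm_num
    rw [e]
    have hLL : L ≤ L ^ 2 := by nlinarith
    have hp : 0 ≤ U ^ (1 / 2 - a) := by positivity
    nlinarith [mul_le_mul_of_nonneg_right hLL hp]
  calc Real.sqrt (B' / N₁) ≤ Real.sqrt ((4.5 * L * U ^ (1 / 4 - a / 2)) ^ 2) :=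
        Real.sqrt_le_sqrt (h1.trans h2)
    _ = 4.5 * L * U ^ (1 / 4 - a / 2) := Real.sqrt_sq (by positivity)

/-- Error bookkeeping for the two Montgomery–Vaughan error terms with `Y₁ = ⌊√(N₁B')⌋`,
`u = √N₁`, `v = √B'`, `v ≤ u`, `B ≤ B' = v²`: the sum of the two errors is at most
`(16(log N + 1) + 4)·(v/u) + 16W` when `4N₁/N ≤ 16W`. [folklore] -/
private theorem err_facts {B N₁ u v Y₁ N ℓN ℓ₁ W : ℝ} (hBv : B ≤ v ^ 2)
    (hu : 0 < u) (hv : 0 < v) (hu2 : u ^ 2 = N₁) (hvu : v ≤ u)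
    (hY₁le : Y₁ ≤ u * v) (hY₁gt : u * v < Y₁ + 1) (hℓ₁0 : 0 ≤ ℓ₁)
    (hℓ₁N : ℓ₁ ≤ ℓN) (h4 : 4 * N₁ / N ≤ 16 * W) :
    (8 * B * (ℓN + 1) / (N₁ + 1) + 4 * N₁ / N) +
        (8 * B * (ℓ₁ + 1) / (Y₁ + 1) + 4 * Y₁ / N₁) ≤
      (16 * (ℓN + 1) + 4) * (v / u) + 16 * W := by
  subst hu2
  have hB0 : 0 ≤ B ∨ B < 0 := le_or_gt 0 B
  have hρ0 : 0 < v / u := div_pos hv hu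
  have hρ1 : v / u ≤ 1 := (div_le_one hu).mpr hvu
  have hℓN0 : 0 ≤ ℓN := hℓ₁0.trans hℓ₁N
  have hY₁1 : 0 < Y₁ + 1 := by nlinarith [mul_pos hu hv]
  have p1 : 8 * B * (ℓ₁ + 1) / (Y₁ + 1) ≤ 8 * (ℓN + 1) * (v / u) := by
    have h1 : 8 * B * (ℓ₁ + 1) / (Y₁ + 1) ≤ 8 * v ^ 2 * (ℓN + 1) / (u * v) := by
      have hnum : 8 * B * (ℓ₁ + 1) ≤ 8 * v ^ 2 * (ℓN + 1) := by
        nlinarith [mul_le_mul hBv (by linarith : ℓ₁ + 1 ≤ ℓN + 1) (by linarith) (sq_nonneg v)]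
      exact div_le_div₀ (by positivity) hnum (by positivity) hY₁gt.le
    have h2 : 8 * v ^ 2 * (ℓN + 1) / (u * v) = 8 * (ℓN + 1) * (v / u) := by
      field_simp
    linarith [h1, h2.le]
  have p2 : 4 * Y₁ / u ^ 2 ≤ 4 * (v / u) := by
    have h1 : 4 * Y₁ / u ^ 2 ≤ 4 * (u * v) / u ^ 2 := by gcongr
    have h2 : 4 * (u * v) / u ^ 2 = 4 * (v / u) := by
      field_simp
    linarith [h1, h2.le]
  have p3 : 8 * B * (ℓN + 1) / (u ^ 2 + 1) ≤ 8 * (ℓN + 1) * (v / u) := by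
    have h1 : 8 * B * (ℓN + 1) / (u ^ 2 + 1) ≤ 8 * v ^ 2 * (ℓN + 1) / u ^ 2 := by
      have hnum : 8 * B * (ℓN + 1) ≤ 8 * v ^ 2 * (ℓN + 1) := by
        nlinarith [mul_le_mul_of_nonneg_right hBv (by linarith : 0 ≤ ℓN + 1)]
      exact div_le_div₀ (by positivity) hnum (by positivity) (by linarith)
    have h2 : 8 * v ^ 2 * (ℓN + 1) / u ^ 2 = 8 * (ℓN + 1) * (v / u) * (v / u) := by
      field_simp
    have h3 : 8 * (ℓN + 1) * (v / u) * (v / u) ≤ 8 * (ℓN + 1) * (v / u) * 1 :=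
      mul_le_mul_of_nonneg_left hρ1 (by positivity)
    linarith [h1, h2.le, h3]
  linarith [p1, p2, p3, h4]

/-- The Pólya–Vinogradov data for the second Montgomery–Vaughan cut: with `B = 9√D log D`
(`Pintz1976Heilbronn.norm_partialSum_le_nine`), `B' = ⌈B⌉ ≤ N₁` (threshold
`20 log U · U^{1/2−a} ≤ 1`, `U^a/2 ≤ N₁`), `Y₁ = ⌊√(N₁B')⌋ ∈ [2, N₁]`, `u = √N₁`, `v = √B'`:
`v/u ≤ 4.5 log U · U^{1/4 − a/2}`. [folklore] -/
private theorem pv_second_cut [NeZero q] (hχ : χ ≠ 1) (hq3 : 3 ≤ q) {U a : ℝ}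
    (hqU : (q : ℝ) ≤ U) (hL1 : 1 ≤ Real.log U) (hT5 : 20 * Real.log U * U ^ (1 / 2 - a) ≤ 1)
    {N₁ : ℕ} (hXN₁ : U ^ a / 2 ≤ N₁) (hN₁7 : 7 ≤ N₁) :
    ∃ (B u v : ℝ) (Y₁ : ℕ), (∀ n, ‖partialSum χ n‖ ≤ B) ∧ 0 ≤ B ∧ B ≤ v ^ 2 ∧ 0 < u ∧ 0 < v ∧
      u ^ 2 = (N₁ : ℝ) ∧ v ≤ u ∧ (Y₁ : ℝ) ≤ u * v ∧ u * v < (Y₁ : ℝ) + 1 ∧ 2 ≤ Y₁ ∧ Y₁ ≤ N₁ ∧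
      v / u ≤ 4.5 * Real.log U * U ^ (1 / 4 - a / 2) := by
  have hq3r : (3 : ℝ) ≤ q := by exact_mod_cast hq3
  have hq0 : (0 : ℝ) < q := by linarith
  have hU1 : 1 ≤ U := by linarith
  have hU0 : 0 < U := by linarith
  have hN₁r : (7 : ℝ) ≤ N₁ := by exact_mod_cast hN₁7
  have hN₁0 : (0 : ℝ) < N₁ := by linarith
  have hXa0 : 0 < U ^ a := by positivity
  have hB : ∀ n, ‖partialSum χ n‖ ≤ 9 * Real.sqrt q * Real.log q :=
    norm_partialSum_le_nine χ hχ hq3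
  have hlq0 : 0 < Real.log q := Real.log_pos (by linarith)
  have hsq0 : 0 < Real.sqrt q := Real.sqrt_pos.mpr hq0
  have hBpos : 0 < 9 * Real.sqrt q * Real.log q := by positivity
  -- `B' = ⌈B⌉`
  obtain ⟨B', hBB', hB'B⟩ : ∃ B' : ℕ, 9 * Real.sqrt q * Real.log q ≤ (B' : ℝ) ∧
      (B' : ℝ) < 9 * Real.sqrt q * Real.log q + 1 :=
    ⟨⌈9 * Real.sqrt q * Real.log q⌉₊, Nat.le_ceil _, Nat.ceil_lt_add_one hBpos.le⟩
  have hB'0 : (0 : ℝ) < B' := by linarith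
  have hB'pos : 0 < B' := by exact_mod_cast hB'0
  have hsq : Real.sqrt q ≤ Real.sqrt U := Real.sqrt_le_sqrt hqU
  have hlq : Real.log q ≤ Real.log U := Real.log_le_log hq0 hqU
  have hsU1 : 1 ≤ Real.sqrt U := by
    have := Real.sqrt_le_sqrt hU1
    rwa [Real.sqrt_one] at this
  have hB9 : 9 * Real.sqrt q * Real.log q ≤ 9 * Real.sqrt U * Real.log U :=
    mul_le_mul (mul_le_mul_of_nonneg_left hsq (by norm_num)) hlq hlq0.le (by positivity)
  have hB'10 : (B' : ℝ) ≤ 10 * Real.sqrt U * Real.log U := by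
    have : (1 : ℝ) ≤ Real.sqrt U * Real.log U := one_le_mul_of_one_le_of_one_le hsU1 hL1
    linarith
  have hB'N₁r : (B' : ℝ) ≤ N₁ := by
    have e : 20 * Real.log U * U ^ (1 / 2 - a) * U ^ a = 20 * Real.sqrt U * Real.log U := by
      rw [Real.sqrt_eq_rpow, show 20 * Real.log U * U ^ (1 / 2 - a) * U ^ a =
        20 * Real.log U * (U ^ (1 / 2 - a) * U ^ a) by ring, ← Real.rpow_add hU0]
      ring_nf
    have h1 : 20 * Real.sqrt U * Real.log U ≤ U ^ a := by
      have := mul_le_mul_of_nonneg_right hT5 hXa0.le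
      rwa [e, one_mul] at this
    linarith
  have hB'N₁ : B' ≤ N₁ := by exact_mod_cast hB'N₁r
  -- `Y₁ = ⌊√(N₁B')⌋`
  obtain ⟨Y₁, hY₁sq, hY₁lt⟩ : ∃ Y₁ : ℕ, Y₁ ^ 2 ≤ N₁ * B' ∧ N₁ * B' < (Y₁ + 1) ^ 2 :=
    ⟨Nat.sqrt (N₁ * B'), Nat.sqrt_le' _, Nat.lt_succ_sqrt' _⟩
  have hY₁2 : 2 ≤ Y₁ := by
    by_contra h
    have h' : Y₁ ≤ 1 := by omega
    have h1 : (Y₁ + 1) ^ 2 ≤ 4 := by nlinarith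
    have h2 : 7 ≤ N₁ * B' := le_trans hN₁7 (Nat.le_mul_of_pos_right _ hB'pos)
    omega
  have hY₁N₁ : Y₁ ≤ N₁ := by
    by_contra h
    have h' : N₁ + 1 ≤ Y₁ := by omega
    have h1 : (N₁ + 1) ^ 2 ≤ Y₁ ^ 2 := Nat.pow_le_pow_left h' 2
    have h2 : N₁ * B' ≤ N₁ * N₁ := Nat.mul_le_mul_left _ hB'N₁
    nlinarith
  -- real square roots
  have hY₁sqr : ((Y₁ : ℝ)) ^ 2 ≤ (N₁ : ℝ) * B' := by exact_mod_cast hY₁sq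
  have hY₁ltr : (N₁ : ℝ) * B' < ((Y₁ : ℝ) + 1) ^ 2 := by exact_mod_cast hY₁lt
  have hu0 : 0 < Real.sqrt N₁ := Real.sqrt_pos.mpr hN₁0
  have hv0 : 0 < Real.sqrt B' := Real.sqrt_pos.mpr hB'0
  have hu2 : Real.sqrt N₁ ^ 2 = (N₁ : ℝ) := Real.sq_sqrt hN₁0.le
  have hv2 : Real.sqrt B' ^ 2 = (B' : ℝ) := Real.sq_sqrt hB'0.le
  have hvu : Real.sqrt B' ≤ Real.sqrt N₁ := Real.sqrt_le_sqrt hB'N₁r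
  have huv : Real.sqrt ((N₁ : ℝ) * B') = Real.sqrt N₁ * Real.sqrt B' := Real.sqrt_mul hN₁0.le _
  have hY₁le : (Y₁ : ℝ) ≤ Real.sqrt N₁ * Real.sqrt B' := by
    rw [← huv, ← Real.sqrt_sq (Nat.cast_nonneg Y₁)]
    exact Real.sqrt_le_sqrt hY₁sqr
  have hY₁gt : Real.sqrt N₁ * Real.sqrt B' < (Y₁ : ℝ) + 1 := by
    rw [← huv, ← Real.sqrt_sq (by positivity : (0 : ℝ) ≤ (Y₁ : ℝ) + 1)]
    exact Real.sqrt_lt_sqrt (by positivity) hY₁ltr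
  have hρ : Real.sqrt B' / Real.sqrt N₁ ≤ 4.5 * Real.log U * U ^ (1 / 4 - a / 2) := by
    rw [← Real.sqrt_div hB'0.le]
    exact sqrt_ratio_le hU1 hL1 hB'10 hXN₁ hN₁0
  refine ⟨9 * Real.sqrt q * Real.log q, Real.sqrt N₁, Real.sqrt B', Y₁, hB, hBpos.le, ?_, hu0, hv0,
    hu2, hvu, hY₁le, hY₁gt, hY₁2, hY₁N₁, hρ⟩
  rw [hv2]; exact hBB'

/-- The real-arithmetic assembly: from the bounds on each factor of `Σ₁` and `Σ₂` and the
threshold `500(b+2)³ log⁴U · U^{−e} ≤ 0.014`, `Σ₁ + PQ(R₁ + R₂) ≤ 0.014` and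
`PQ(log N − log N₁) ≤ (b+2)³ log³U · U^{bγ'}`. [folklore] -/
private theorem assembly_arith {H₁ N₁pow KQ A ℓN ℓ₁ Mpow P P' QN R₁ R₂ ρ U L b e a γ : ℝ}
    (hU1 : 1 ≤ U) (hL1 : 1 ≤ L) (hb : 0 < b)
    (hH₁ : H₁ ≤ (b + 2) ^ 2 * L ^ 2)
    (hN₁pow : N₁pow ≤ U ^ (a * γ)) (hN₁pow0 : 0 ≤ N₁pow)
    (hKA : KQ * A ≤ 3 * U) (hKQ0 : 0 ≤ KQ) (hA0 : 0 ≤ A)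
    (hℓN2 : 2 + ℓN ≤ (b + 2) * L) (hℓN0 : 0 ≤ ℓN)
    (hℓ₁0 : 0 ≤ ℓ₁) (hℓ₁N : ℓ₁ ≤ ℓN)
    (hMpow : Mpow ≤ 3 * U ^ ((b - a) * (γ - 1 / 2))) (hMpow0 : 0 ≤ Mpow)
    (hPP' : P ≤ P') (hP'γ : P' ≤ U ^ (b * γ)) (hP0 : 0 ≤ P)
    (hQN : QN ≤ (b + 2) ^ 2 * L ^ 2) (hQN0 : 0 ≤ QN)
    (hR : R₁ + R₂ ≤ (16 * (ℓN + 1) + 4) * ρ + 16 * U ^ (a - b)) (hR0 : 0 ≤ R₁ + R₂)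
    (hρ : ρ ≤ 4.5 * L * U ^ (1 / 4 - a / 2)) (hρ0 : 0 ≤ ρ)
    (hW1 : U ^ (a * γ) * U * U ^ ((b - a) * (γ - 1 / 2)) = U ^ (-(3 * e)))
    (hW2 : U ^ (b * γ) * U ^ (1 / 4 - a / 2) = U ^ (-e))
    (hW3 : U ^ (b * γ) * U ^ (a - b) ≤ U ^ (-e)) (hW4 : U ^ (-(3 * e)) ≤ U ^ (-e))
    (hT : 500 * (b + 2) ^ 3 * L ^ 4 * U ^ (-e) ≤ 0.014) :
    H₁ * (N₁pow * (4 * KQ * A * (2 + ℓN) * Mpow)) + P * QN * (R₁ + R₂) ≤ 0.014 ∧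
      P * QN * (ℓN - ℓ₁) ≤ (b + 2) ^ 3 * L ^ 3 * P' ∧ 0 ≤ P * QN * (ℓN - ℓ₁) := by
  have hU0 : 0 < U := by linarith
  have hL0 : 0 < L := by linarith
  have hC1 : 1 ≤ b + 2 := by linarith
  set C : ℝ := (b + 2) ^ 3 with hCdef
  set W : ℝ := U ^ (-e) with hWdef
  have hW0 : 0 ≤ W := by positivity
  have hC0 : 0 < C := by positivity
  -- `Σ₁ ≤ 36 C L⁴ W`
  have h4F : 4 * KQ * A ≤ 12 * U := by nlinarith
  have hT₁ : 4 * KQ * A * (2 + ℓN) * Mpow ≤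
      12 * U * ((b + 2) * L) * (3 * U ^ ((b - a) * (γ - 1 / 2))) := by
    have h1 : 4 * KQ * A * (2 + ℓN) ≤ 12 * U * ((b + 2) * L) :=
      mul_le_mul h4F hℓN2 (by positivity) (by positivity)
    exact mul_le_mul h1 hMpow hMpow0 (by positivity)
  have hE : H₁ * (N₁pow * (4 * KQ * A * (2 + ℓN) * Mpow)) ≤ 36 * C * L ^ 4 * W := by
    have hL34 : L ^ 3 ≤ L ^ 4 := pow_le_pow_right₀ hL1 (by norm_num)
    have h1 : N₁pow * (4 * KQ * A * (2 + ℓN) * Mpow) ≤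
        U ^ (a * γ) * (12 * U * ((b + 2) * L) * (3 * U ^ ((b - a) * (γ - 1 / 2)))) :=
      mul_le_mul hN₁pow hT₁ (by positivity) (by positivity)
    have h2 : H₁ * (N₁pow * (4 * KQ * A * (2 + ℓN) * Mpow)) ≤ ((b + 2) ^ 2 * L ^ 2) *
        (U ^ (a * γ) * (12 * U * ((b + 2) * L) * (3 * U ^ ((b - a) * (γ - 1 / 2))))) :=
      mul_le_mul hH₁ h1 (by positivity) (by positivity)
    calc _ ≤ _ := h2
      _ = 36 * C * L ^ 3 * (U ^ (a * γ) * U * U ^ ((b - a) * (γ - 1 / 2))) := by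
          simp only [hCdef]; ring
      _ = 36 * C * L ^ 3 * U ^ (-(3 * e)) := by rw [hW1]
      _ ≤ 36 * C * L ^ 4 * W :=
          mul_le_mul (mul_le_mul_of_nonneg_left hL34 (by positivity)) hW4 (by positivity)
            (by positivity)
  -- `PQ(R₁ + R₂) ≤ 106 C L⁴ W`
  have hR' : R₁ + R₂ ≤ 20 * ((b + 2) * L) * (4.5 * L * U ^ (1 / 4 - a / 2)) + 16 * U ^ (a - b) := by
    have h1 : (16 * (ℓN + 1) + 4) * ρ ≤ 20 * ((b + 2) * L) * ρ := by
      apply mul_le_mul_of_nonneg_right _ hρ0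
      have : 1 ≤ (b + 2) * L := one_le_mul_of_one_le_of_one_le hC1 hL1
      linarith
    have h2 : 20 * ((b + 2) * L) * ρ ≤ 20 * ((b + 2) * L) * (4.5 * L * U ^ (1 / 4 - a / 2)) :=
      mul_le_mul_of_nonneg_left hρ (by positivity)
    linarith
  have hPQR : P * QN * (R₁ + R₂) ≤ 106 * C * L ^ 4 * W := by
    have hL24 : L ^ 2 ≤ L ^ 4 := pow_le_pow_right₀ hL1 (by norm_num)
    have h3 : (b + 2) ^ 2 ≤ (b + 2) ^ 3 := pow_le_pow_right₀ hC1 (by norm_num)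
    have hPγ : P ≤ U ^ (b * γ) := hPP'.trans hP'γ
    have h1 : P * QN * (R₁ + R₂) ≤ U ^ (b * γ) * ((b + 2) ^ 2 * L ^ 2) *
        (20 * ((b + 2) * L) * (4.5 * L * U ^ (1 / 4 - a / 2)) + 16 * U ^ (a - b)) :=
      mul_le_mul (mul_le_mul hPγ hQN hQN0 (by positivity)) hR' hR0 (by positivity)
    have h2 : (b + 2) ^ 2 * L ^ 2 * (U ^ (b * γ) * U ^ (a - b)) ≤ (b + 2) ^ 3 * L ^ 4 * W :=
      mul_le_mul (mul_le_mul h3 hL24 (by positivity) (by positivity)) hW3 (by positivity)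
        (by positivity)
    calc P * QN * (R₁ + R₂) ≤ _ := h1
      _ = 90 * C * L ^ 4 * (U ^ (b * γ) * U ^ (1 / 4 - a / 2)) +
            16 * ((b + 2) ^ 2 * L ^ 2 * (U ^ (b * γ) * U ^ (a - b))) := by
          simp only [hCdef]; ring
      _ ≤ 90 * C * L ^ 4 * W + 16 * ((b + 2) ^ 3 * L ^ 4 * W) := by rw [hW2]; linarith
      _ = 106 * C * L ^ 4 * W := by simp only [hCdef]; ring
  have hsmall : H₁ * (N₁pow * (4 * KQ * A * (2 + ℓN) * Mpow)) + P * QN * (R₁ + R₂) ≤ 0.014 := by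
    have hCLW : 0 ≤ C * L ^ 4 * W := by positivity
    have hT' : 500 * C * L ^ 4 * W ≤ 0.014 := hT
    linarith [hE, hPQR]
  -- `PQ(log N − log N₁) ≤ C L³ P'`
  have hD0 : 0 ≤ ℓN - ℓ₁ := by linarith
  have hDL : ℓN - ℓ₁ ≤ (b + 2) * L := by linarith
  have hP'0 : 0 ≤ P' := hP0.trans hPP'
  have hPQD : P * QN * (ℓN - ℓ₁) ≤ (b + 2) ^ 3 * L ^ 3 * P' := by
    calc P * QN * (ℓN - ℓ₁) ≤ P' * ((b + 2) ^ 2 * L ^ 2) * ((b + 2) * L) :=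
          mul_le_mul (mul_le_mul hPP' hQN hQN0 hP'0) hDL hD0 (by positivity)
      _ = (b + 2) ^ 3 * L ^ 3 * P' := by ring
  exact ⟨hsmall, hPQD, mul_nonneg (mul_nonneg hP0 hQN0) hD0⟩

/-- A non-principal Dirichlet character has modulus `≥ 3`. [folklore] -/
private theorem three_le_of_ne_one'' {n : ℕ} [NeZero n] {ψ : DirichletCharacter ℂ n}
    (hψ : ψ ≠ 1) : 3 ≤ n := by
  by_contra h
  have h' : n < 3 := not_le.mp h
  have hn0 : n ≠ 0 := NeZero.ne n
  interval_cases n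
  · exact hn0 rfl
  · exact hψ (DirichletCharacter.level_one ψ)
  · apply hψ
    refine MulChar.ext' fun a => ?_
    by_cases ha : IsUnit a
    · obtain ⟨u, rfl⟩ := ha
      have hu : u = 1 := Subsingleton.elim (h := by
        rw [← Fintype.card_le_one_iff_subsingleton, ZMod.card_units_eq_totient]; decide) u 1
      rw [hu]; simp
    · rw [MulChar.map_nonunit _ ha, MulChar.map_nonunit _ ha]

/-! ### Part O — the large-`U` case and the cores in the window `b > 5/(2(1 − 4γ))` -/

/-- **The large-`U` case of Theorem 2, sharper window.** With the cut `N₁ = ⌊U^a⌋`,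
`a = bγ + b/4 − 1/8`, the top `N = ⌊U^{b/2}⌋²`, the Pólya–Vinogradov bound `9√D log D` in the
Montgomery–Vaughan error terms (second cut `Y₁ = ⌊√(N₁⌈9√D log D⌉)⌋`) and the thresholds in force,
a zero `s = 1 − γ' + it` of `L(·, χ_k)` (`0 < γ' ≤ γ < 1/4`; `χ_k` real or `γ' ≤ 1/8`) gives
`L(1, χ_D) ≥ 0.014/((b+2)³ U^{bγ'} log³U)` as soon as `e = b(1−4γ)/8 − 5/16 > 0`.
[cite: BellottiPuglisi2023, §3 pp. 11–16 (general `h`)] -/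
theorem large_case_sharp [NeZero k] [NeZero q] (hq : χ ^ 2 = 1) (hχ : χ ≠ 1) (hχk : χk ≠ 1)
    (hψ : prodChar χ χk ≠ 1) {s : ℂ} {γ γ' b a e : ℝ} (hγ'0 : 0 < γ') (hγ'γ : γ' ≤ γ)
    (hγ4 : γ < 1 / 4) (hb : 0 < b) (hsre : s.re = 1 - γ')
    (ha : a = b * γ + b / 4 - 1 / 8) (he : e = b * (1 - 4 * γ) / 8 - 5 / 16) (he0 : 0 < e)
    (hcase : χk ^ 2 = 1 ∨ γ' ≤ 1 / 8) (hz : χk.LFunction s = 0) {U : ℝ}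
    (hU : U = (k : ℝ) * ‖s‖ * q) (hq3 : 3 ≤ q) (hqU : (q : ℝ) ≤ U) (hL1 : 1 ≤ Real.log U)
    (hX145 : 145 ≤ U ^ (b / 2)) (h8 : 8 ≤ U ^ (b - a)) (h8a : 8 ≤ U ^ a)
    (hT : 500 * (b + 2) ^ 3 * Real.log U ^ 4 * U ^ (-e) ≤ 0.014)
    (hT5 : 20 * Real.log U * U ^ (1 / 2 - a) ≤ 1) :
    0.014 / ((b + 2) ^ 3 * U ^ (b * γ') * Real.log U ^ 3) ≤ (χ.LFunction 1).re := by
  have hσ34 : 3 / 4 < s.re := by rw [hsre]; linarith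
  have hσ1 : s.re ≤ 1 := by rw [hsre]; linarith
  have hhalf : 1 / 2 ≤ s.re := by linarith
  have hs0 : 0 < s.re := by linarith
  have hns : s.re ≤ ‖s‖ := Complex.re_le_norm s
  have hq3r : (3 : ℝ) ≤ q := by exact_mod_cast hq3
  have hU1 : 1 ≤ U := by linarith
  have hU0 : 0 < U := by linarith
  have hL0 : 0 < Real.log U := by linarith
  have hγσ : 1 - s.re = γ' := by rw [hsre]; ring
  have hγσ' : 1 / 2 - s.re = γ' - 1 / 2 := by rw [hsre]; ring
  -- `M = ⌊U^{b/2}⌋`, `N = M²`, `N₁ = ⌊U^a⌋`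
  obtain ⟨M, hMX, hXM1⟩ : ∃ M : ℕ, (M : ℝ) ≤ U ^ (b / 2) ∧ U ^ (b / 2) < M + 1 :=
    ⟨⌊U ^ (b / 2)⌋₊, Nat.floor_le (by positivity), Nat.lt_floor_add_one _⟩
  have hMge : (144 : ℝ) ≤ M := by linarith
  have hM144 : 144 ≤ M := by exact_mod_cast hMge
  have hXM : U ^ (b / 2) / 2 ≤ M := by linarith
  have hM1r : (1 : ℝ) ≤ M := by linarith
  obtain ⟨N₁, hN₁X, hXaN₁⟩ : ∃ N₁ : ℕ, (N₁ : ℝ) ≤ U ^ a ∧ U ^ a < N₁ + 1 :=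
    ⟨⌊U ^ a⌋₊, Nat.floor_le (by positivity), Nat.lt_floor_add_one _⟩
  have hN₁ge : (7 : ℝ) ≤ N₁ := by linarith
  have hN₁7 : 7 ≤ N₁ := by exact_mod_cast hN₁ge
  have hXN₁ : U ^ a / 2 ≤ N₁ := by linarith
  have hN₁1r : (1 : ℝ) ≤ N₁ := by linarith
  have hN₁0 : (0 : ℝ) < N₁ := by linarith
  obtain ⟨hPow1, hPow2, hPow3, hP'γ, hPow5, hW1, hW2, hW3, hW4, hN₁N, -, hNle⟩ :=
    cut_power_facts hU1 ha he hγ'0 hγ'γ hγ4 hb hMX hXM hM1r hN₁X hN₁1r h8 he0.le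
  have hN₁Nnat : N₁ ≤ M ^ 2 := by exact_mod_cast hN₁N
  have hN0 : (0 : ℝ) < (((M ^ 2 : ℕ)) : ℝ) := lt_of_lt_of_le hN₁0 hN₁N
  have hN1 : (1 : ℝ) ≤ (((M ^ 2 : ℕ)) : ℝ) := hN₁1r.trans hN₁N
  -- the Pólya–Vinogradov data for the second cut
  obtain ⟨B, u, v, Y₁, hB, hB0, hBv, hu0, hv0, hu2, hvu, hY₁le, hY₁gt, hY₁2, hY₁N₁, hρ⟩ :=
    pv_second_cut χ hχ hq3 hqU hL1 hT5 hXN₁ hN₁7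
  -- lower bound (Part C′ of the `h = 2` file)
  have hlow : (0.028 : ℝ) ≤
      ‖∑ l ∈ Ioc 0 M, χk ((l ^ 2 : ℕ) : ZMod k) * ((l ^ 2 : ℕ) : ℂ) ^ (-s)‖ := by
    rcases hcase with hquad | hγ8
    · have := norm_sum_sq_ge_real χk hquad hσ34.le hM144
      linarith
    · exact norm_sum_sq_ge_of_ge_seven_eighths χk (by rw [hsre]; linarith) (by omega)
  -- the upper chain (Part M)
  have hup := upper_chain_cut χ χk hq hχ hχk hψ hhalf hσ1 hz hB hY₁2 hY₁N₁ hN₁Nnat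
  -- logarithms and the remaining factors
  have hℓN : Real.log (((M ^ 2 : ℕ)) : ℝ) ≤ b * Real.log U := by
    have := Real.log_le_log hN0 hNle
    rwa [Real.log_rpow hU0] at this
  have hℓN0 : 0 ≤ Real.log (((M ^ 2 : ℕ)) : ℝ) := Real.log_nonneg hN1
  have hℓ₁0 : 0 ≤ Real.log (N₁ : ℝ) := Real.log_nonneg hN₁1r
  have hℓ₁N : Real.log (N₁ : ℝ) ≤ Real.log (((M ^ 2 : ℕ)) : ℝ) := Real.log_le_log hN₁0 hN₁N
  obtain ⟨hQN, -, hℓN2⟩ := logb_facts hℓN0 hℓN hL1 hb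
  obtain ⟨hQ₁, -, -⟩ := logb_facts hℓ₁0 (hℓ₁N.trans hℓN) hL1 hb
  have hH₁ := (sum_card_divisors_div_le N₁).trans hQ₁
  have hQN0 : 0 ≤ Real.log (((M ^ 2 : ℕ)) : ℝ) ^ 2 / 2 + 2 * Real.log (((M ^ 2 : ℕ)) : ℝ) + 2 := by
    positivity
  have hF3 := F_le_three_mul (k := k) (q := q) hσ34 hns
  rw [← hU] at hF3
  have hKQ0 : 0 ≤ ((k * q : ℕ) : ℝ) := Nat.cast_nonneg _
  have hA0 : 0 ≤ 1 + ‖s‖ / s.re := by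
    have : 0 ≤ ‖s‖ / s.re := div_nonneg (norm_nonneg _) hs0.le
    linarith
  have hPow1' : (N₁ : ℝ) ^ (1 - s.re) ≤ U ^ (a * γ) := by rw [hγσ]; exact hPow1
  have hPow2' : (((M ^ 2 / N₁ : ℕ)) : ℝ) ^ (1 / 2 - s.re) ≤ 3 * U ^ ((b - a) * (γ - 1 / 2)) := by
    rw [hγσ']; exact hPow2
  have hPP' : (((M ^ 2 : ℕ)) : ℝ) ^ (1 - s.re) ≤ U ^ (b * γ') := by rw [hγσ]; exact hPow3
  have hN₁pow0 : 0 ≤ (N₁ : ℝ) ^ (1 - s.re) := by positivity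
  have hMpow0 : 0 ≤ (((M ^ 2 / N₁ : ℕ)) : ℝ) ^ (1 / 2 - s.re) := by positivity
  have hP0 : 0 ≤ (((M ^ 2 : ℕ)) : ℝ) ^ (1 - s.re) := by positivity
  have hρ0 : 0 ≤ v / u := by positivity
  -- the error terms
  have hR := err_facts (B := B) (N := (((M ^ 2 : ℕ)) : ℝ)) (W := U ^ (a - b))
    (ℓN := Real.log (((M ^ 2 : ℕ)) : ℝ)) hBv hu0 hv0 hu2 hvu hY₁le hY₁gt hℓ₁0 hℓ₁N hPow5
  have hR0 : 0 ≤ (8 * B * (Real.log (((M ^ 2 : ℕ)) : ℝ) + 1) / ((N₁ : ℝ) + 1) +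
      4 * (N₁ : ℝ) / (((M ^ 2 : ℕ)) : ℝ)) +
      (8 * B * (Real.log (N₁ : ℝ) + 1) / ((Y₁ : ℝ) + 1) + 4 * (Y₁ : ℝ) / N₁) := by positivity
  -- the assembly and the endgame
  obtain ⟨hsmall, hPQD, hPQD0⟩ := assembly_arith hU1 hL1 hb hH₁ hPow1' hN₁pow0 hF3 hKQ0 hA0
    hℓN2 hℓN0 hℓ₁0 hℓ₁N hPow2' hMpow0 hPP' hP'γ hP0 hQN hQN0 hR hR0 hρ hρ0 hW1 hW2 hW3 hW4 hT
  exact endgame_gen2 hlow hup hsmall hPQD hPQD0 (by positivity) hL0 (by positivity)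

/-- **Theorem 2, uniform quantitative core, sharper window.** For `0 < γ < 1/4` and
`b > 5/(2(1 − 4γ))` there is `c₁ = c₁(γ, b) > 0` such that: for every `χ_k ≠ χ₀` mod `k`, every
zero `s₀ = 1 − γ' + it` of `L(s, χ_k)` with `0 < γ' ≤ γ` (`χ_k` real, or `γ' ≤ 1/8`), and every
real `χ_D ≠ χ₀` mod `D` with `χ_kχ_D ≠ χ₀`: `L(1, χ_D) ≥ c₁/(U^{bγ'} log³U)`, `U = k|s₀|D`.
Constants: `c₁ = min(0.014/(b+2)³, m)`, `m` the minimum of `L(1, χ)` over the quadratic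
characters of modulus below the threshold.
[cite: BellottiPuglisi2023, Theorem 2 p. 4; proof §3 pp. 11–16] -/
theorem theorem2_core_sharp {γ b : ℝ} (hγ : 0 < γ) (hγ4 : γ < 1 / 4)
    (hb : 5 / (2 * (1 - 4 * γ)) < b) :
    ∃ c₁ : ℝ, 0 < c₁ ∧ ∀ (k : ℕ) [NeZero k] (χk : DirichletCharacter ℂ k), χk ≠ 1 →
      ∀ γ' t : ℝ, 0 < γ' → γ' ≤ γ → (χk ^ 2 = 1 ∨ γ' ≤ 1 / 8) →
      χk.LFunction (1 - γ' + t * Complex.I) = 0 →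
        ∀ (q : ℕ) [NeZero q] (χ : DirichletCharacter ℂ q), χ ≠ 1 → χ ^ 2 = 1 →
          prodChar χ χk ≠ 1 →
            c₁ / (((k : ℝ) * ‖(1 - γ' + t * Complex.I : ℂ)‖ * q) ^ (b * γ') *
                Real.log ((k : ℝ) * ‖(1 - γ' + t * Complex.I : ℂ)‖ * q) ^ 3) ≤
              (χ.LFunction 1).re := by
  have h14 : 0 < 1 - 4 * γ := by linarith
  have hb0 : 5 / 2 < b * (1 - 4 * γ) := by
    have h2 : 0 < 2 * (1 - 4 * γ) := by linarith
    have := (div_lt_iff₀ h2).mp hb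
    linarith
  have hbpos : 0 < b := by nlinarith
  set a : ℝ := b * γ + b / 4 - 1 / 8 with hadef
  set e : ℝ := b * (1 - 4 * γ) / 8 - 5 / 16 with hedef
  have he0 : 0 < e := by simp only [hedef]; linarith
  have hba : a < b := by simp only [hadef]; nlinarith
  have ha12 : 1 / 2 < a := by simp only [hadef]; nlinarith [mul_pos hbpos hγ]
  set C : ℝ := (b + 2) ^ 3 with hCdef
  have hC : 0 < C := by positivity
  obtain ⟨U₀, hU₀1, hU₀⟩ := eventually_thresholds_sharp hba ha12 he0
    (by positivity : (0 : ℝ) < 500 * C) (by norm_num : (0 : ℝ) < 0.014)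
  obtain ⟨m, hm, hmP⟩ := exists_pos_le_LFunction_one ⌈U₀⌉₊
  have hc₁0 : 0 < min (0.014 / C) m := lt_min (by positivity) hm
  refine ⟨min (0.014 / C) m, hc₁0, ?_⟩
  intro k _ χk hχk γ' t hγ'0 hγ'γ hcase hz q _ χ hχ hq hψ
  set s : ℂ := 1 - γ' + t * Complex.I with hsdef
  have hsre : s.re = 1 - γ' := by simp [hsdef]
  have hσ34 : 3 / 4 < s.re := by rw [hsre]; linarith
  have hns : s.re ≤ ‖s‖ := Complex.re_le_norm s
  have hns34 : 3 / 4 < ‖s‖ := lt_of_lt_of_le hσ34 hns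
  have hk3 : 3 ≤ k := three_le_of_ne_one'' hχk
  have hq3 : 3 ≤ q := three_le_of_ne_one'' hχ
  obtain ⟨hU675, hqU, -, hL1⟩ := size_facts hk3 hq3 hns34
  set U : ℝ := (k : ℝ) * ‖s‖ * q with hUdef
  have hU1 : 1 ≤ U := by norm_num at hU675; linarith
  set L : ℝ := Real.log U with hLdef
  set P' : ℝ := U ^ (b * γ') with hP'def
  have hP'1 : 1 ≤ P' := Real.one_le_rpow hU1 (by positivity)
  have hden1 : 1 ≤ P' * L ^ 3 := one_le_mul_of_one_le_of_one_le hP'1 (one_le_pow₀ hL1)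
  rcases lt_or_ge U U₀ with hUsmall | hUlarge
  · -- small `U`: `D ≤ ⌈U₀⌉` and `L(1, χ_D) ≥ m ≥ c₁ ≥ c₁/(U^{bγ'} log³U)`
    have hqle : q ≤ ⌈U₀⌉₊ := by
      have : (q : ℝ) ≤ ⌈U₀⌉₊ := (hqU.trans hUsmall.le).trans (Nat.le_ceil U₀)
      exact_mod_cast this
    have hmL := hmP q χ hqle hχ hq
    calc min (0.014 / C) m / (P' * L ^ 3) ≤ min (0.014 / C) m := div_le_self hc₁0.le hden1
      _ ≤ m := min_le_right _ _
      _ ≤ (χ.LFunction 1).re := hmL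
  · -- large `U`
    obtain ⟨hX145, h8, h8a, -, hT4, hT5⟩ := hU₀ U hUlarge
    have hkey := large_case_sharp χ χk hq hχ hχk hψ hγ'0 hγ'γ hγ4 hbpos hsre hadef hedef he0
      hcase hz hUdef hq3 hqU hL1 hX145 h8 h8a hT4 hT5
    calc min (0.014 / C) m / (P' * L ^ 3) ≤ (0.014 / C) / (P' * L ^ 3) :=
          div_le_div_of_nonneg_right (min_le_left _ _) (by positivity)
      _ = 0.014 / (C * P' * L ^ 3) := by rw [div_div, mul_assoc]
      _ ≤ (χ.LFunction 1).re := by simpa only [hCdef, hP'def, hLdef, mul_assoc] using hkey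

/-- **Theorem 3, uniform quantitative core, sharper window.** Same data as
`theorem2_core_sharp`; every real zero `1 − δ` (`δ > 0`) of `L(s, χ_D)` has
`δ > c₁/(U^{bγ'} log⁵U)`. From `theorem2_core_sharp` and Page's step
`‖L(1, χ_D)‖ ≤ 0.7 δ log²D` (`Pintz1976Heilbronn.norm_LFunction_one_le_of_realZero`, `log D ≥ 100`);
for `log D < 100` by continuity at `1` over the finitely many characters.
[cite: BellottiPuglisi2023, Theorem 3 p. 4; proof §4 p. 16] -/
theorem theorem3_core_sharp {γ b : ℝ} (hγ : 0 < γ) (hγ4 : γ < 1 / 4)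
    (hb : 5 / (2 * (1 - 4 * γ)) < b) :
    ∃ c₁ : ℝ, 0 < c₁ ∧ ∀ (k : ℕ) [NeZero k] (χk : DirichletCharacter ℂ k), χk ≠ 1 →
      ∀ γ' t : ℝ, 0 < γ' → γ' ≤ γ → (χk ^ 2 = 1 ∨ γ' ≤ 1 / 8) →
      χk.LFunction (1 - γ' + t * Complex.I) = 0 →
        ∀ (q : ℕ) [NeZero q] (χ : DirichletCharacter ℂ q), χ ≠ 1 → χ ^ 2 = 1 →
          prodChar χ χk ≠ 1 → ∀ d : ℝ, 0 < d → χ.LFunction ((1 - d : ℝ) : ℂ) = 0 →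
            c₁ / (((k : ℝ) * ‖(1 - γ' + t * Complex.I : ℂ)‖ * q) ^ (b * γ') *
                Real.log ((k : ℝ) * ‖(1 - γ' + t * Complex.I : ℂ)‖ * q) ^ 5) < d := by
  obtain ⟨c₁, hc₁, h2⟩ := theorem2_core_sharp hγ hγ4 hb
  obtain ⟨r₀, hr₀, hr₀P⟩ := exists_zeroFree_near_one ⌈Real.exp 100⌉₊
  have hbpos : 0 < b := by
    have h2' : 0 < 2 * (1 - 4 * γ) := by linarith
    have := (div_lt_iff₀ h2').mp hb; nlinarith
  refine ⟨min c₁ r₀, lt_min hc₁ hr₀, ?_⟩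
  intro k _ χk hχk γ' t hγ'0 hγ'γ hcase hz q _ χ hχ hq hψ d hd hzd
  have hmain := h2 k χk hχk γ' t hγ'0 hγ'γ hcase hz q χ hχ hq hψ
  set s : ℂ := 1 - γ' + t * Complex.I with hsdef
  have hsre : s.re = 1 - γ' := by simp [hsdef]
  have hσ34 : 3 / 4 < s.re := by rw [hsre]; linarith
  have hns : s.re ≤ ‖s‖ := Complex.re_le_norm s
  have hns34 : 3 / 4 < ‖s‖ := lt_of_lt_of_le hσ34 hns
  have hk3 : 3 ≤ k := three_le_of_ne_one'' hχk
  have hq3 : 3 ≤ q := three_le_of_ne_one'' hχ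
  obtain ⟨hU675, hqU, -, hL1⟩ := size_facts hk3 hq3 hns34
  set U : ℝ := (k : ℝ) * ‖s‖ * q with hUdef
  have hU1 : 1 ≤ U := by norm_num at hU675; linarith
  have hU0 : 0 < U := by linarith
  set L : ℝ := Real.log U with hLdef
  have hL0 : 0 < L := by linarith
  set P' : ℝ := U ^ (b * γ') with hP'def
  have hP'1 : 1 ≤ P' := Real.one_le_rpow hU1 (by positivity)
  have hP'0 : 0 < P' := by linarith
  have hden1 : 1 ≤ P' * L ^ 5 := one_le_mul_of_one_le_of_one_le hP'1 (one_le_pow₀ hL1)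
  have hq0 : (0 : ℝ) < q := by exact_mod_cast (show 0 < q by omega)
  have hc0 : 0 < min c₁ r₀ := lt_min hc₁ hr₀
  rcases lt_or_ge (Real.log q) 100 with hsmall | hlarge
  · -- `log D < 100`: no real zero in `[1 − r₀, 1]`, so `d > r₀ ≥ min c₁ r₀ ≥ …`
    have hqle : q ≤ ⌈Real.exp 100⌉₊ := by
      have h1 : (q : ℝ) < Real.exp 100 := by
        rw [← Real.exp_log hq0]; exact Real.exp_lt_exp.mpr hsmall
      have : (q : ℝ) ≤ ⌈Real.exp 100⌉₊ := h1.le.trans (Nat.le_ceil _)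
      exact_mod_cast this
    have hfree := hr₀P q χ hqle hχ hq
    have hdr : r₀ < d := by
      by_contra hle
      push Not at hle
      exact hfree (1 - d) (by linarith) (by linarith) hzd
    calc min c₁ r₀ / (P' * L ^ 5) ≤ min c₁ r₀ := div_le_self hc0.le hden1
      _ ≤ r₀ := min_le_right _ _
      _ < d := hdr
  · -- `log D ≥ 100`: Page's step `L(1, χ_D) ≤ 0.7 δ log²D ≤ 0.7 δ log²U`
    have hpage := norm_LFunction_one_le_of_realZero χ hχ hlarge hzd
    have hδ' : (1 : ℝ) - (1 - d) = d := by ring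
    rw [hδ'] at hpage
    have hlogq : Real.log q ≤ L := Real.log_le_log hq0 hqU
    have hlogq0 : 0 ≤ Real.log q := by linarith
    have hL₁le : (χ.LFunction 1).re ≤ 0.7 * d * L ^ 2 := by
      refine (Complex.re_le_norm _).trans (hpage.trans ?_)
      have : Real.log q ^ 2 ≤ L ^ 2 := pow_le_pow_left₀ hlogq0 hlogq 2
      have hd0 : 0 ≤ 0.7 * d := by positivity
      nlinarith
    have h1 : c₁ / (P' * L ^ 3) ≤ 0.7 * d * L ^ 2 := hmain.trans hL₁le
    have h2 : c₁ ≤ 0.7 * d * L ^ 2 * (P' * L ^ 3) := (div_le_iff₀ (by positivity)).mp h1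
    have h3 : min c₁ r₀ / (P' * L ^ 5) ≤ c₁ / (P' * L ^ 5) :=
      div_le_div_of_nonneg_right (min_le_left _ _) (by positivity)
    refine lt_of_le_of_lt h3 ?_
    rw [div_lt_iff₀ (by positivity)]
    nlinarith [mul_pos hd (mul_pos hP'0 (pow_pos hL0 5))]

end BellottiPuglisi2023

/-! ### The theorems in the shape of the statement file, with the window `b > 5/(2(1 − 4γ))` -/

open BellottiPuglisi2023 Pintz1976Heilbronn in
/-- **Bellotti–Puglisi 2023, Theorem 2 — PROVED in the window `b > 5/(2(1 − 4γ))`.** For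
`0 < γ` and `b > 5/(2(1 − 4γ))` there is `c₁ > 0` such that for every `χ_k ≠ χ₀` mod `k` (real
with `γ < 1/4`, or arbitrary with `γ ≤ 1/8`) with `L(1 − γ + it, χ_k) = 0`, and every real
`χ_D ≠ χ₀` mod `D` with `χ_kχ_D` non-principal: `L(1, χ_D) ≥ c₁/(U^{bγ} log³U)`, `U = k|s₀|D` —
the body of the named fact `bellottiPuglisi2023_theorem2` verbatim with its (mis-parsed, and in
print unsupported) window replaced by `5/(2(1 − 4γ)) < b`; improves the window `4/(1 − 4γ) < b` of
`bellottiPuglisi2023_theorem2_largeB` by the cut `U^{bγ + b/4 − 1/8}` and Pólya–Vinogradov in the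
Montgomery–Vaughan error terms. [cite: BellottiPuglisi2023, Theorem 2 p. 4; §3 pp. 11–16] -/
theorem bellottiPuglisi2023_theorem2_sharperB :
    ∀ γ b : ℝ, 0 < γ → 5 / (2 * (1 - 4 * γ)) < b → ∃ c₁ : ℝ, 0 < c₁ ∧
      ∀ (k : ℕ) [NeZero k] (χk : DirichletCharacter ℂ k), χk ≠ 1 →
        (χk.IsQuadratic ∧ γ < 1 / 4 ∨ γ ≤ 1 / 8) →
        ∀ t : ℝ, χk.LFunction (1 - γ + t * Complex.I) = 0 →
          ∀ (D : ℕ) [NeZero D] (χD : DirichletCharacter ℂ D), χD ≠ 1 → χD.IsQuadratic →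
            ProductNonprincipal χk χD →
              c₁ / (((k : ℝ) * ‖(1 - γ + t * Complex.I : ℂ)‖ * D) ^ (b * γ) *
                  Real.log ((k : ℝ) * ‖(1 - γ + t * Complex.I : ℂ)‖ * D) ^ 3) ≤
                (χD.LFunction 1).re := by
  intro γ b hγ hb
  by_cases hγ4 : γ < 1 / 4
  · obtain ⟨c₁, hc₁, h⟩ := theorem2_core_sharp hγ hγ4 hb
    refine ⟨c₁, hc₁, fun k _ χk hχk hcase t hz D _ χD hχD hquad hprod => ?_⟩
    have hcase' : χk ^ 2 = 1 ∨ γ ≤ 1 / 8 := by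
      rcases hcase with ⟨hq, _⟩ | h8
      · exact Or.inl hq.sq_eq_one
      · exact Or.inr h8
    exact h k χk hχk γ t hγ le_rfl hcase' hz D χD hχD hquad.sq_eq_one hprod
  · -- vacuous: both alternatives force `γ < 1/4`
    refine ⟨1, one_pos, fun k _ χk hχk hcase => ?_⟩
    exfalso
    rcases hcase with ⟨_, h4⟩ | h8
    · exact hγ4 h4
    · exact hγ4 (by linarith)

open BellottiPuglisi2023 Pintz1976Heilbronn in
/-- **Bellotti–Puglisi 2023, Theorem 3 — PROVED in the window `b > 5/(2(1 − 4γ))`.** Same data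
as Theorem 2; every real zero `1 − δ` (`δ > 0`) of `L(s, χ_D)` has `δ > c₁/(U^{bγ} log⁵U)`. The body
of `bellottiPuglisi2023_theorem3` verbatim with the window replaced. Theorem 2 (above) and Page's
step in the tree's form `‖L(1, χ_D)‖ ≤ 0.7 δ log²D` (`log D ≥ 100`), the small moduli by continuity.
[cite: BellottiPuglisi2023, Theorem 3 p. 4; §4 p. 16] -/
theorem bellottiPuglisi2023_theorem3_sharperB :
    ∀ γ b : ℝ, 0 < γ → 5 / (2 * (1 - 4 * γ)) < b → ∃ c₁ : ℝ, 0 < c₁ ∧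
      ∀ (k : ℕ) [NeZero k] (χk : DirichletCharacter ℂ k), χk ≠ 1 →
        (χk.IsQuadratic ∧ γ < 1 / 4 ∨ γ ≤ 1 / 8) →
        ∀ t : ℝ, χk.LFunction (1 - γ + t * Complex.I) = 0 →
          ∀ (D : ℕ) [NeZero D] (χD : DirichletCharacter ℂ D), χD ≠ 1 → χD.IsQuadratic →
            ProductNonprincipal χk χD →
              ∀ δ : ℝ, 0 < δ → χD.LFunction ((1 - δ : ℝ) : ℂ) = 0 →
                c₁ / (((k : ℝ) * ‖(1 - γ + t * Complex.I : ℂ)‖ * D) ^ (b * γ) *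
                    Real.log ((k : ℝ) * ‖(1 - γ + t * Complex.I : ℂ)‖ * D) ^ 5) < δ := by
  intro γ b hγ hb
  by_cases hγ4 : γ < 1 / 4
  · obtain ⟨c₁, hc₁, h⟩ := theorem3_core_sharp hγ hγ4 hb
    refine ⟨c₁, hc₁, fun k _ χk hχk hcase t hz D _ χD hχD hquad hprod δ hδ hzδ => ?_⟩
    have hcase' : χk ^ 2 = 1 ∨ γ ≤ 1 / 8 := by
      rcases hcase with ⟨hq, _⟩ | h8
      · exact Or.inl hq.sq_eq_one
      · exact Or.inr h8
    exact h k χk hχk γ t hγ le_rfl hcase' hz D χD hχD hquad.sq_eq_one hprod δ hδ hzδ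
  · refine ⟨1, one_pos, fun k _ χk hχk hcase => ?_⟩
    exfalso
    rcases hcase with ⟨_, h4⟩ | h8
    · exact hγ4 h4
    · exact hγ4 (by linarith)

open BellottiPuglisi2023 Pintz1976Heilbronn in
/-- **Bellotti–Puglisi 2023, Corollary 3 — PROVED in the window `b > 5/(1 − 4γ)`.** For
`0 < γ ≤ 1/8` and `b > 5/(1 − 4γ)` there is `c₁ > 0` such that at most one primitive real character
(equal moduli and equal values) has a real zero in `[1 − min(γ, c₁/(32 log⁵D · D^{bγ})), 1]` — the
body of `bellottiPuglisi2023_corollary3` verbatim with the window replaced (improving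
`bellottiPuglisi2023_corollary3_largeB`'s `8/(1 − 4γ)`). From Theorem 3 at `b/2`
(`BellottiPuglisi2023.corollary3_oneway`: the character with the smaller modulus supplies the
auxiliary zero, `U ≤ D²`; distinct primitive real characters have a non-principal product).
[cite: BellottiPuglisi2023, Corollary 3 p. 5] -/
theorem bellottiPuglisi2023_corollary3_sharperB :
    ∀ γ b : ℝ, 0 < γ → γ ≤ 1 / 8 → 5 / (1 - 4 * γ) < b → ∃ c₁ : ℝ, 0 < c₁ ∧
      ∀ (D₁ : ℕ) [NeZero D₁] (χ₁ : DirichletCharacter ℂ D₁) (D₂ : ℕ) [NeZero D₂]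
        (χ₂ : DirichletCharacter ℂ D₂),
        χ₁.IsQuadratic → χ₁.IsPrimitive → χ₁ ≠ 1 → χ₂.IsQuadratic → χ₂.IsPrimitive → χ₂ ≠ 1 →
        (∃ σ₁ : ℝ, 1 - min γ (c₁ / (32 * Real.log D₁ ^ 5 * (D₁ : ℝ) ^ (b * γ))) ≤ σ₁ ∧ σ₁ ≤ 1 ∧
            χ₁.LFunction (σ₁ : ℂ) = 0) →
        (∃ σ₂ : ℝ, 1 - min γ (c₁ / (32 * Real.log D₂ ^ 5 * (D₂ : ℝ) ^ (b * γ))) ≤ σ₂ ∧ σ₂ ≤ 1 ∧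
            χ₂.LFunction (σ₂ : ℂ) = 0) →
          D₁ = D₂ ∧ ∀ n : ℕ, χ₁ (n : ZMod D₁) = χ₂ (n : ZMod D₂) := by
  intro γ b hγ hγ8 hb
  have hγ4 : γ < 1 / 4 := by linarith
  have h14 : 0 < 1 - 4 * γ := by linarith
  have hb2 : 5 / (2 * (1 - 4 * γ)) < b / 2 := by
    have h2 : 0 < 2 * (1 - 4 * γ) := by linarith
    rw [div_lt_iff₀ h14] at hb
    rw [div_lt_iff₀ h2]
    linarith
  have hbpos : 0 < b := by
    have := (div_lt_iff₀ h14).mp hb; nlinarith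
  obtain ⟨c₁, hc₁, hT3⟩ := theorem3_core_sharp hγ hγ4 hb2
  refine ⟨c₁, hc₁, ?_⟩
  intro D₁ _ χ₁ D₂ _ χ₂ h₁q h₁p h₁ h₂q h₂p h₂ ⟨σ₁, hσ₁, hσ₁1, hz₁⟩ ⟨σ₂, hσ₂, hσ₂1, hz₂⟩
  by_contra hne
  have hmin₁ : 1 - γ ≤ σ₁ := by
    have := min_le_left γ (c₁ / (32 * Real.log D₁ ^ 5 * (D₁ : ℝ) ^ (b * γ))); linarith
  have hmin₁' : 1 - c₁ / (32 * Real.log D₁ ^ 5 * (D₁ : ℝ) ^ (b * γ)) ≤ σ₁ := by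
    have := min_le_right γ (c₁ / (32 * Real.log D₁ ^ 5 * (D₁ : ℝ) ^ (b * γ))); linarith
  have hmin₂ : 1 - γ ≤ σ₂ := by
    have := min_le_left γ (c₁ / (32 * Real.log D₂ ^ 5 * (D₂ : ℝ) ^ (b * γ))); linarith
  have hmin₂' : 1 - c₁ / (32 * Real.log D₂ ^ 5 * (D₂ : ℝ) ^ (b * γ)) ≤ σ₂ := by
    have := min_le_right γ (c₁ / (32 * Real.log D₂ ^ 5 * (D₂ : ℝ) ^ (b * γ))); linarith
  rcases le_total D₁ D₂ with hD | hD
  · have hprod : ProductNonprincipal χ₁ χ₂ := productNonprincipal_of_not_same h₁p h₂p h₂q hne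
    exact corollary3_oneway hγ4 hbpos hT3 hc₁ hD h₁q.sq_eq_one h₁ h₂q.sq_eq_one h₂ hprod hmin₁
      hσ₁1 hz₁ hmin₂' hz₂
  · have hne' : ¬ (D₂ = D₁ ∧ ∀ n : ℕ, χ₂ (n : ZMod D₂) = χ₁ (n : ZMod D₁)) := by
      rintro ⟨hDD, hval⟩
      exact hne ⟨hDD.symm, fun n => (hval n).symm⟩
    have hprod : ProductNonprincipal χ₂ χ₁ := productNonprincipal_of_not_same h₂p h₁p h₁q hne'
    exact corollary3_oneway hγ4 hbpos hT3 hc₁ hD h₂q.sq_eq_one h₂ h₁q.sq_eq_one h₁ hprod hmin₂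
      hσ₂1 hz₂ hmin₁' hz₁

end Literature.NumberTheory.LFunctions

end
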